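import Mathlib.Analysis.Normed.Module.FiniteDimension
import Mathlib.Topology.Algebra.Module.FiniteDimension
import Mathlib.Analysis.Calculus.ContDiff.Operations
import Mathlib.MeasureTheory.Measure.Lebesgue.EqHaar
import Mathlib.MeasureTheory.Integral.Prod
import Mathlib.MeasureTheory.Function.L2Space
import Literature.Analysis.FluidPDE.SelfSimilarProofs
import Literature.Analysis.FluidPDE.PoincareBall
import Literature.Analysis.FluidPDE.ForwardDSSExistence
import HarnessLib

/-!
# Bradshaw–Tsai 2019, Lemma 4.1: approximation of DSS data in `L²_loc` — discharge

Analysis/FluidPDE proofs file over `ForwardDSSExistence.lean` (sibling of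
`ForwardDSSExistenceProofs.lean`, which relates the other named facts of that file). It proves the
named fact
`Literature.Analysis.FluidPDE.bradshawTsai2019_lemma_4_1` (Z. Bradshaw, T.-P. Tsai, *Discretely
self-similar solutions to the Navier–Stokes equations with data in `L²_loc` satisfying the local
energy inequality*, Analysis & PDE 12 (2019) = arXiv:1801.08060, **Lemma 4.1**, arXiv p. 11):

> Let `f ∈ L²_loc(ℝ³; ℝ³)` be a divergence free `λ`-DSS vector field, `λ > 1`. There is a sequence
> of divergence free `λ`-DSS vector fields `φ⁽ᵏ⁾ ∈ L³_w(ℝ³)` with `‖φ⁽ᵏ⁾ − f‖_{L²(B₁)} → 0`.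

as `bradshawTsai2019_lemma_4_1_holds : bradshawTsai2019_lemma_4_1` (sorry-free, no new facts).

## The proof given here

The printed proof (loc. cit. §4.1) localizes `f` to `λ`-adic annuli with a radial partition of
unity, corrects the divergence with **Bogovskiĭ's operator** (Lemma 4.2 = Galdi, III.3), smooths on
one annulus and sums over the scaling orbit. Bogovskiĭ's `L² → W^{1,2}_0` bound is
Calderón–Zygmund theory, which the tree does not have. This file proves the lemma by a different,
elementary construction — **averaging over linear changes of variables**:

* For `a = (a₀, a₁, a₂) ∈ (ℝ³)³` let `T_a x = x + ∑ⱼ xⱼ aⱼ` (`LinearDeformation.deform`) and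
  `S_a = T_a⁻¹` (`LinearDeformation.deformInv`); for `‖a‖ < ρ` (`LinearDeformation.radius`,
  `ρ ≤ 1/6`, chosen by continuity of the determinant) `|det T_a − 1| < 1/2`, `‖T_a x − x‖ ≤ ‖x‖/2`,
  `‖S_a‖ ≤ 2`, and `∫ G(T_a x) dx = |det T_a|⁻¹ ∫ G` (`LinearDeformation.lintegral_comp_deform`).
* The conjugate field `x ↦ S_a f(T_a x)` is weakly divergence free when `f` is (test against
  `θ ∘ S_a`, `LinearDeformation.isWeaklyDivFree_conj`) and is `λ`-DSS when `f` is, *pointwise*,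
  because linear maps commute with `x ↦ λx` (`LinearDeformation.nsRescaleData_conj`).
* The **average** `A_r f(x) = vol(Q_r)⁻¹ ∫_{Q_r} S_a f(T_a x) da` over the parameter ball
  `Q_r = {‖a‖ < r}`, `0 < r ≤ ρ` (`LinearDeformation.average`), is therefore `λ`-DSS
  (`nsRescaleData_average`) and weakly divergence free (`isWeaklyDivFree_average`: Fubini, the
  integrand `⟪S_a f(T_a x), ∇θ(x)⟫` being integrable on `ℝ³ × Q_r`,
  `integrable_inner_conj_gradient`).
* **Integrability gain.** `T_a x = x_{j₀} a_{j₀} + w` with `w` independent of the column `a_{j₀}`;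
  for the largest coordinate `|x_{j₀}| ≥ ‖x‖/√3` the substitution `y = x_{j₀} a_{j₀} + w` in that
  column gives `∫_{Q_r} ‖f(T_a x)‖ da ≤ vol(B_r)² |x_{j₀}|⁻³ ∫_{B(0,2‖x‖)} ‖f‖`
  (`setLIntegral_paramBall_comp_deform_le`), so `A_r f` is *bounded* on the annulus
  `1 ≤ ‖x‖ < λ` by a local `L¹` norm of `f` (`enorm_average_le`); by self-similarity
  `‖A_r f(x)‖ ≤ C/‖x‖` (`BradshawTsai2019.norm_le_div_norm_of_nsRescaleData`), hence
  `A_r f ∈ L³_w` (`BradshawTsai2019.memWeakLp_three_of_norm_le_div_norm`, Grafakos Ex. 1.1.7) —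
  this is the printed `|φ⁽ᵏ⁾(x)| ≤ c_k |x|⁻¹`.
* **Convergence.** `∫_{B₁} ‖S_a f(T_a x) − f(x)‖² dx → 0` as `a → 0` (approximate `f 1_{B₃}` in `L²`
  by a continuous compactly supported field, Mathlib's `MemLp.exists_hasCompactSupport_eLpNorm_sub_le`;
  `exists_forall_setLIntegral_conj_sub_sq_le`), and by Cauchy–Schwarz in `a` and Tonelli
  `∫_{B₁} ‖A_r f − f‖² ≤ sup_{‖a‖<r} ∫_{B₁} ‖S_a f(T_a ·) − f‖²` (`setLIntegral_average_sub_sq_le`).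
* The fact's `f` is only a.e.-strongly measurable while its DSS identity is pointwise; it is first
  replaced by a Borel representative that is still pointwise DSS (indicator of a `λ^ℤ`-invariant
  conull measurable set times the measurable modification,
  `BradshawTsai2019.exists_measurable_dss_representative`). Then `φ⁽ᵏ⁾ = A_{r_k} g` with radii
  `r_k` giving `L²(B₁)`-error `≤ (k+1)⁻¹`.

All auxiliary statements are standard measure theory ([folklore]); the determinant, the inverse
`ContinuousLinearMap.inverse`, the change of variables `Measure.map_linearMap_addHaar_eq_smul_addHaar`,
the column splitting `MeasurableEquiv.piFinSuccAbove` and Tonelli/Fubini are Mathlib's.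

## References

* Z. Bradshaw, T.-P. Tsai, Analysis & PDE 12 (2019) 1943–1962 = arXiv:1801.08060, Lemma 4.1 and
  its proof, §4.1 (arXiv p. 11) [BradshawTsai2019].
* L. Grafakos, *Classical Fourier Analysis*, 3rd ed., GTM 249 (2014), Example 1.1.7
  (`|x|^{-n/p} ∈ L^{p,∞}`).
-/

noncomputable section

open MeasureTheory Set Function Filter Metric Module
open scoped NNReal ENNReal InnerProductSpace RealInnerProductSpace Topology

namespace Literature.Analysis.FluidPDE

/-- Local notation for physical space `ℝ³ = EuclideanSpace ℝ (Fin 3)`. -/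
local notation "ℝ³" => EuclideanSpace ℝ (Fin 3)

namespace LinearDeformation

/-! ### The deformation family `T_a x = x + ∑ⱼ xⱼ aⱼ` -/

/-- The linear map `T_a = 1 + ∑ⱼ eⱼ* ⊗ aⱼ` of `ℝ³`, `T_a x = x + ∑ⱼ xⱼ aⱼ`, for a parameter
`a = (a₀, a₁, a₂) ∈ (ℝ³)³` (the matrix `1 + [a₀ a₁ a₂]`). [folklore] -/
def deform (a : Fin 3 → ℝ³) : ℝ³ →L[ℝ] ℝ³ :=
  ContinuousLinearMap.id ℝ ℝ³ + ∑ j : Fin 3, (EuclideanSpace.proj j).smulRight (a j)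

/-- `T_a x = x + ∑ⱼ xⱼ aⱼ`. [folklore] -/
theorem deform_apply (a : Fin 3 → ℝ³) (x : ℝ³) : deform a x = x + ∑ j, x j • a j := by
  simp [deform, ContinuousLinearMap.smulRight_apply]

/-- `T_0 = 1`. [folklore] -/
@[simp]
theorem deform_zero : deform 0 = ContinuousLinearMap.id ℝ ℝ³ := by
  refine ContinuousLinearMap.ext fun x => ?_
  simp [deform_apply]

/-- `‖∑ⱼ xⱼ aⱼ‖ ≤ 3 ‖a‖ ‖x‖` (sup norm on the parameter). [folklore] -/
theorem norm_sum_smul_le (a : Fin 3 → ℝ³) (x : ℝ³) : ‖∑ j, x j • a j‖ ≤ 3 * ‖a‖ * ‖x‖ := by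
  calc ‖∑ j, x j • a j‖ ≤ ∑ j, ‖x j • a j‖ := norm_sum_le _ _
    _ ≤ ∑ _j : Fin 3, ‖x‖ * ‖a‖ := Finset.sum_le_sum fun j _ => by
        rw [norm_smul]
        exact mul_le_mul (PiLp.norm_apply_le x j) (norm_le_pi_norm a j) (norm_nonneg _)
          (norm_nonneg _)
    _ = 3 * ‖a‖ * ‖x‖ := by
        simp only [Finset.sum_const, Finset.card_univ, Fintype.card_fin, nsmul_eq_mul]
        push_cast
        ring

/-- `‖T_a x − x‖ ≤ 3 ‖a‖ ‖x‖`. [folklore] -/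
theorem norm_deform_sub_self_le (a : Fin 3 → ℝ³) (x : ℝ³) : ‖deform a x - x‖ ≤ 3 * ‖a‖ * ‖x‖ := by
  rw [deform_apply, add_sub_cancel_left]
  exact norm_sum_smul_le a x

/-- `T_a x − T_b x = ∑ⱼ xⱼ (aⱼ − bⱼ)`. [folklore] -/
theorem deform_sub_deform_apply (a b : Fin 3 → ℝ³) (x : ℝ³) :
    deform a x - deform b x = ∑ j, x j • (a - b) j := by
  simp only [deform_apply, Pi.sub_apply, smul_sub, Finset.sum_sub_distrib]
  abel

/-- `‖T_a − T_b‖ ≤ 3 ‖a − b‖`: the family is `3`-Lipschitz in operator norm. [folklore] -/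
theorem opNorm_deform_sub_le (a b : Fin 3 → ℝ³) : ‖deform a - deform b‖ ≤ 3 * ‖a - b‖ :=
  ContinuousLinearMap.opNorm_le_bound _ (by positivity) fun x => by
    rw [FunLike.coe_sub, Pi.sub_apply, deform_sub_deform_apply]
    exact norm_sum_smul_le (a - b) x

/-- The family `a ↦ T_a` is Lipschitz, hence continuous, into `ℝ³ →L[ℝ] ℝ³`. [folklore] -/
theorem lipschitzWith_deform : LipschitzWith 3 deform :=
  LipschitzWith.of_dist_le_mul fun a b => by
    rw [dist_eq_norm, dist_eq_norm, NNReal.coe_ofNat]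
    exact opNorm_deform_sub_le a b

/-- Continuity of `a ↦ T_a` in operator norm. [folklore] -/
theorem continuous_deform : Continuous deform :=
  lipschitzWith_deform.continuous

/-- Joint continuity of `(a, x) ↦ T_a x`. [folklore] -/
theorem continuous_deform_apply₂ : Continuous fun p : (Fin 3 → ℝ³) × ℝ³ => deform p.1 p.2 :=
  isBoundedBilinearMap_apply.continuous.comp (continuous_deform.prodMap continuous_id)

/-! ### Small parameters: invertibility with uniform constants -/

/-- There is `ρ ∈ (0, 1/6]` such that `|det T_a − 1| < 1/2` whenever `‖a‖ < ρ` (continuity of the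
determinant at the identity). [folklore] -/
theorem exists_radius : ∃ ρ : ℝ, 0 < ρ ∧ ρ ≤ 6⁻¹ ∧
    ∀ a : Fin 3 → ℝ³, ‖a‖ < ρ → |(deform a).det - 1| < 2⁻¹ := by
  have hc : ContinuousAt (fun a => (deform a).det) 0 :=
    (ContinuousLinearMap.continuous_det.comp continuous_deform).continuousAt
  have h0 : (deform (0 : Fin 3 → ℝ³)).det = 1 := by
    rw [deform_zero]
    exact LinearMap.det_id
  rw [ContinuousAt, h0, Metric.tendsto_nhds_nhds] at hc
  obtain ⟨δ, hδ, h⟩ := hc 2⁻¹ (by norm_num)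
  refine ⟨min δ 6⁻¹, lt_min hδ (by norm_num), min_le_right _ _, fun a ha => ?_⟩
  have h1 := h (x := a) (by simpa [dist_zero_right] using lt_of_lt_of_le ha (min_le_left _ _))
  rwa [Real.dist_eq] at h1

/-- A radius `ρ ∈ (0, 1/6]` of parameters `a` for which `T_a` is uniformly invertible
(`exists_radius`). [folklore] -/
def radius : ℝ := exists_radius.choose

/-- `0 < ρ`. [folklore] -/
theorem radius_pos : 0 < radius := exists_radius.choose_spec.1

/-- `ρ ≤ 1/6`. [folklore] -/
theorem radius_le : radius ≤ 6⁻¹ := exists_radius.choose_spec.2.1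

/-- `|det T_a − 1| < 1/2` for `‖a‖ < ρ`. [folklore] -/
theorem abs_det_deform_sub_one_lt {a : Fin 3 → ℝ³} (ha : ‖a‖ < radius) :
    |(deform a).det - 1| < 2⁻¹ :=
  exists_radius.choose_spec.2.2 a ha

/-- `1/2 < det T_a` for `‖a‖ < ρ`. [folklore] -/
theorem half_lt_det_deform {a : Fin 3 → ℝ³} (ha : ‖a‖ < radius) : 2⁻¹ < (deform a).det := by
  have h := abs_det_deform_sub_one_lt ha
  rw [abs_lt] at h
  linarith [h.1]

/-- `det T_a ≠ 0` for `‖a‖ < ρ`. [folklore] -/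
theorem det_deform_ne_zero {a : Fin 3 → ℝ³} (ha : ‖a‖ < radius) : (deform a).det ≠ 0 :=
  (lt_trans (by norm_num) (half_lt_det_deform ha)).ne'

/-- `|det T_a|⁻¹ ≤ 2` for `‖a‖ < ρ` (the Jacobian factor of the substitution `y = T_a x`). [folklore] -/
theorem abs_inv_det_deform_le {a : Fin 3 → ℝ³} (ha : ‖a‖ < radius) : |((deform a).det)⁻¹| ≤ 2 := by
  have h := half_lt_det_deform ha
  have hpos : 0 < (deform a).det := lt_trans (by norm_num) h
  rw [abs_of_pos (inv_pos.2 hpos), inv_le_comm₀ hpos two_pos]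
  exact h.le

/-- `‖T_a x − x‖ ≤ ‖x‖/2` for `‖a‖ < ρ`. [folklore] -/
theorem norm_deform_sub_self_le_half {a : Fin 3 → ℝ³} (ha : ‖a‖ < radius) (x : ℝ³) :
    ‖deform a x - x‖ ≤ 2⁻¹ * ‖x‖ := by
  refine (norm_deform_sub_self_le a x).trans (mul_le_mul_of_nonneg_right ?_ (norm_nonneg x))
  have h := radius_le
  nlinarith [norm_nonneg a]

/-- `‖T_a x‖ ≤ (3/2)‖x‖` for `‖a‖ < ρ`. [folklore] -/
theorem norm_deform_le {a : Fin 3 → ℝ³} (ha : ‖a‖ < radius) (x : ℝ³) :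
    ‖deform a x‖ ≤ 3 / 2 * ‖x‖ := by
  have h := norm_deform_sub_self_le_half ha x
  have h2 : ‖deform a x‖ ≤ ‖deform a x - x‖ + ‖x‖ := norm_le_norm_sub_add _ _
  linarith

/-- `‖x‖ ≤ 2‖T_a x‖` for `‖a‖ < ρ`. [folklore] -/
theorem norm_le_two_mul_norm_deform {a : Fin 3 → ℝ³} (ha : ‖a‖ < radius) (x : ℝ³) :
    ‖x‖ ≤ 2 * ‖deform a x‖ := by
  have h := norm_deform_sub_self_le_half ha x
  have h2 : ‖x‖ ≤ ‖x - deform a x‖ + ‖deform a x‖ := norm_le_norm_sub_add _ _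
  rw [norm_sub_rev] at h2
  linarith

/-- `‖T_a x‖ < 2‖x‖` for `‖a‖ < ρ` and `x ≠ 0`. [folklore] -/
theorem norm_deform_lt_two_mul {a : Fin 3 → ℝ³} (ha : ‖a‖ < radius) {x : ℝ³} (hx : x ≠ 0) :
    ‖deform a x‖ < 2 * ‖x‖ :=
  (norm_deform_le ha x).trans_lt (by nlinarith [norm_pos_iff.2 hx])

/-- `T_a` as a continuous linear equivalence, `‖a‖ < ρ`. [folklore] -/
def deformEquiv {a : Fin 3 → ℝ³} (ha : ‖a‖ < radius) : ℝ³ ≃L[ℝ] ℝ³ :=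
  (deform a).toContinuousLinearEquivOfDetNeZero (det_deform_ne_zero ha)

/-- The equivalence is `T_a`. [folklore] -/
@[simp]
theorem coe_deformEquiv {a : Fin 3 → ℝ³} (ha : ‖a‖ < radius) :
    (deformEquiv ha : ℝ³ →L[ℝ] ℝ³) = deform a :=
  ContinuousLinearMap.coe_toContinuousLinearEquivOfDetNeZero _ _

/-- The equivalence is `T_a`, pointwise. [folklore] -/
@[simp]
theorem deformEquiv_apply {a : Fin 3 → ℝ³} (ha : ‖a‖ < radius) (x : ℝ³) :
    deformEquiv ha x = deform a x :=
  ContinuousLinearMap.toContinuousLinearEquivOfDetNeZero_apply _ _ x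

/-! ### The inverse family `S_a = T_a⁻¹` -/

/-- `S_a = T_a⁻¹` as a total function of the parameter (Mathlib's `ContinuousLinearMap.inverse`,
`0` where `T_a` is not invertible). [folklore] -/
def deformInv (a : Fin 3 → ℝ³) : ℝ³ →L[ℝ] ℝ³ :=
  (deform a).inverse

/-- For `‖a‖ < ρ`, `S_a` is the inverse equivalence. [folklore] -/
theorem deformInv_eq {a : Fin 3 → ℝ³} (ha : ‖a‖ < radius) :
    deformInv a = ((deformEquiv ha).symm : ℝ³ →L[ℝ] ℝ³) := by
  rw [deformInv, ← coe_deformEquiv ha, ContinuousLinearMap.inverse_equiv]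

/-- `S_0 = 1`. [folklore] -/
@[simp]
theorem deformInv_zero : deformInv 0 = ContinuousLinearMap.id ℝ ℝ³ := by
  rw [deformInv, deform_zero]
  exact ContinuousLinearMap.inverse_id

/-- `S_a (T_a x) = x` for `‖a‖ < ρ`. [folklore] -/
@[simp]
theorem deformInv_deform {a : Fin 3 → ℝ³} (ha : ‖a‖ < radius) (x : ℝ³) :
    deformInv a (deform a x) = x := by
  rw [deformInv_eq ha, ← deformEquiv_apply ha]
  exact (deformEquiv ha).symm_apply_apply x

/-- `T_a (S_a y) = y` for `‖a‖ < ρ`. [folklore] -/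
@[simp]
theorem deform_deformInv {a : Fin 3 → ℝ³} (ha : ‖a‖ < radius) (y : ℝ³) :
    deform a (deformInv a y) = y := by
  rw [deformInv_eq ha, ← deformEquiv_apply ha]
  exact (deformEquiv ha).apply_symm_apply y

/-- `‖S_a y‖ ≤ 2‖y‖` for `‖a‖ < ρ`. [folklore] -/
theorem norm_deformInv_le {a : Fin 3 → ℝ³} (ha : ‖a‖ < radius) (y : ℝ³) :
    ‖deformInv a y‖ ≤ 2 * ‖y‖ := by
  have h := norm_le_two_mul_norm_deform ha (deformInv a y)
  rwa [deform_deformInv ha] at h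

/-- `‖S_a y‖ₑ ≤ 2‖y‖ₑ` for `‖a‖ < ρ`. [folklore] -/
theorem enorm_deformInv_le {a : Fin 3 → ℝ³} (ha : ‖a‖ < radius) (y : ℝ³) :
    ‖deformInv a y‖ₑ ≤ 2 * ‖y‖ₑ := by
  calc ‖deformInv a y‖ₑ = ENNReal.ofReal ‖deformInv a y‖ := (ofReal_norm _).symm
    _ ≤ ENNReal.ofReal (2 * ‖y‖) := ENNReal.ofReal_le_ofReal (norm_deformInv_le ha y)
    _ = 2 * ‖y‖ₑ := by
        rw [ENNReal.ofReal_mul zero_le_two, ofReal_norm, ENNReal.ofReal_ofNat]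

/-- `a ↦ S_a` is continuous at every `‖a‖ < ρ` (inversion is smooth on invertible operators). [folklore] -/
theorem continuousAt_deformInv {a : Fin 3 → ℝ³} (ha : ‖a‖ < radius) : ContinuousAt deformInv a := by
  have h1 : ContinuousAt ContinuousLinearMap.inverse (deform a) := by
    rw [← coe_deformEquiv ha]
    exact (contDiffAt_map_inverse (𝕜 := ℝ) (n := 0) (deformEquiv ha)).continuousAt
  exact h1.comp continuous_deform.continuousAt

/-- `a ↦ S_a` is continuous on the parameter ball `‖a‖ < ρ`. [folklore] -/
theorem continuousOn_deformInv : ContinuousOn deformInv (ball 0 radius) := fun a ha =>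
  (continuousAt_deformInv (a := a) (by simpa using ha)).continuousWithinAt

/-- `S_a → 1` as `a → 0`. [folklore] -/
theorem tendsto_deformInv_zero : Tendsto deformInv (𝓝 0) (𝓝 (ContinuousLinearMap.id ℝ ℝ³)) := by
  have h := continuousAt_deformInv (a := 0) (by simpa using radius_pos)
  rwa [ContinuousAt, deformInv_zero] at h

/-! ### The substitution `y = T_a x` -/

/-- `(T_a)_* vol = |det T_a|⁻¹ vol`. [folklore] -/
theorem map_deform_volume {a : Fin 3 → ℝ³} (ha : ‖a‖ < radius) :
    Measure.map (deform a) volume = ENNReal.ofReal |((deform a).det)⁻¹| • (volume : Measure ℝ³) :=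
  Measure.map_linearMap_addHaar_eq_smul_addHaar volume (det_deform_ne_zero ha)

/-- `T_a` as a measurable equivalence, `‖a‖ < ρ`. [folklore] -/
def deformMeasurableEquiv {a : Fin 3 → ℝ³} (ha : ‖a‖ < radius) : ℝ³ ≃ᵐ ℝ³ :=
  (deformEquiv ha).toHomeomorph.toMeasurableEquiv

/-- The measurable equivalence is `T_a`. [folklore] -/
theorem coe_deformMeasurableEquiv {a : Fin 3 → ℝ³} (ha : ‖a‖ < radius) :
    ⇑(deformMeasurableEquiv ha) = deform a := by
  funext x
  exact deformEquiv_apply ha x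

/-- **Change of variables** `∫ G(T_a x) dx = |det T_a|⁻¹ ∫ G` (Lebesgue integral, unconditional). [folklore] -/
theorem lintegral_comp_deform {a : Fin 3 → ℝ³} (ha : ‖a‖ < radius) (G : ℝ³ → ℝ≥0∞) :
    ∫⁻ x, G (deform a x) = ENNReal.ofReal |((deform a).det)⁻¹| * ∫⁻ y, G y := by
  rw [← coe_deformMeasurableEquiv ha, ← lintegral_map_equiv G (deformMeasurableEquiv ha),
    coe_deformMeasurableEquiv, map_deform_volume ha, lintegral_smul_measure, smul_eq_mul]

/-- `∫ G(T_a x) dx ≤ 2 ∫ G` for `‖a‖ < ρ`. [folklore] -/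
theorem lintegral_comp_deform_le {a : Fin 3 → ℝ³} (ha : ‖a‖ < radius) (G : ℝ³ → ℝ≥0∞) :
    ∫⁻ x, G (deform a x) ≤ 2 * ∫⁻ y, G y := by
  rw [lintegral_comp_deform ha]
  gcongr
  calc ENNReal.ofReal |((deform a).det)⁻¹| ≤ ENNReal.ofReal 2 :=
        ENNReal.ofReal_le_ofReal (abs_inv_det_deform_le ha)
    _ = 2 := ENNReal.ofReal_ofNat 2

/-- **Change of variables** `∫ F(T_a x) dx = |det T_a|⁻¹ ∫ F` (Bochner integral, unconditional). [folklore] -/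
theorem integral_comp_deform {V : Type*} [NormedAddCommGroup V] [NormedSpace ℝ V]
    {a : Fin 3 → ℝ³} (ha : ‖a‖ < radius) (F : ℝ³ → V) :
    ∫ x, F (deform a x) = |((deform a).det)⁻¹| • ∫ y, F y := by
  rw [← coe_deformMeasurableEquiv ha, ← integral_map_equiv (deformMeasurableEquiv ha) F,
    coe_deformMeasurableEquiv, map_deform_volume ha, integral_smul_measure,
    ENNReal.toReal_ofReal (abs_nonneg _)]

/-! ### Conjugated fields `x ↦ S_a f(T_a x)`: divergence and scaling -/

/-- A test function on the whole space composed with a continuous linear equivalence is a test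
function on the whole space (chain rule; the support is the homeomorphic preimage). Deliberate
dot-notation extension of `Literature.Analysis.FunctionSpaces.IsTestFunctionOn`
(`SobolevDomain.lean`), companion of `IsTestFunctionOn.comp_smul_top`. [folklore] -/
theorem _root_.Literature.Analysis.FunctionSpaces.IsTestFunctionOn.comp_continuousLinearEquiv
    {E G : Type*} [NormedAddCommGroup E] [NormedSpace ℝ E] [NormedAddCommGroup G] [NormedSpace ℝ G]
    {θ : E → G} (hθ : FunctionSpaces.IsTestFunctionOn (⊤ : TopologicalSpace.Opens E) θ)
    (e : E ≃L[ℝ] E) : FunctionSpaces.IsTestFunctionOn (⊤ : TopologicalSpace.Opens E) (θ ∘ ⇑e) where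
  contDiff := hθ.contDiff.comp e.contDiff
  hasCompactSupport := hθ.hasCompactSupport.comp_homeomorph e.toHomeomorph
  tsupport_subset := by simp

/-- **Linear changes of variables preserve weak divergence-freeness**: if `∫ ⟪f, ∇θ⟫ = 0` for all
test `θ`, then also for `x ↦ S_a f(T_a x)`, `‖a‖ < ρ` (substitute `y = T_a x` and test against
`θ ∘ S_a`; `⟪S_a v, ∇θ(S_a y)⟫ = ⟪v, ∇(θ ∘ S_a)(y)⟫`). [folklore] -/
theorem isWeaklyDivFree_conj {f : ℝ³ → ℝ³} (hf : IsWeaklyDivFree f) {a : Fin 3 → ℝ³}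
    (ha : ‖a‖ < radius) : IsWeaklyDivFree fun x => deformInv a (f (deform a x)) := by
  intro θ hθ
  set G : ℝ³ → ℝ := fun y => ⟪deformInv a (f y), gradient θ (deformInv a y)⟫ with hGdef
  have hG : ∫ x, ⟪deformInv a (f (deform a x)), gradient θ x⟫ = ∫ x, G (deform a x) := by
    congr 1
    funext x
    simp only [hGdef, deformInv_deform ha]
  rw [hG, integral_comp_deform ha G]
  have hθ' : FunctionSpaces.IsTestFunctionOn (⊤ : TopologicalSpace.Opens ℝ³) (θ ∘ ⇑(deformInv a)) := by
    rw [deformInv_eq ha, ContinuousLinearEquiv.coe_coe]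
    exact hθ.comp_continuousLinearEquiv (deformEquiv ha).symm
  have hd : Differentiable ℝ θ := hθ.contDiff.differentiable (by simp)
  have hpt : ∀ y, ⟪deformInv a (f y), gradient θ (deformInv a y)⟫ =
      ⟪f y, gradient (θ ∘ ⇑(deformInv a)) y⟫ := by
    intro y
    rw [real_inner_gradient_right, real_inner_gradient_right,
      fderiv_comp y (hd _) (deformInv a).differentiableAt, ContinuousLinearMap.fderiv,
      ContinuousLinearMap.comp_apply]
  simp_rw [hGdef, hpt, hf _ hθ', smul_zero]

/-- **Linear changes of variables commute with the DSS scaling**: if `c f(c x) = f(x)` for all `x`,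
then the conjugated field `g(x) = S_a f(T_a x)` satisfies `c g(c x) = g(x)` for all `x`. [folklore] -/
theorem nsRescaleData_conj {f : ℝ³ → ℝ³} {c : ℝ} (hf : nsRescaleData c f = f) (a : Fin 3 → ℝ³) :
    nsRescaleData c (fun x => deformInv a (f (deform a x))) =
      fun x => deformInv a (f (deform a x)) := by
  funext x
  have h := congrFun hf (deform a x)
  rw [nsRescaleData_apply] at h ⊢
  rw [(deform a).map_smul, ← (deformInv a).map_smul, h]


/-! ### The parameter ball and the averaged field -/

/-- The volume of the parameter ball `Q_r = {a : ‖a‖ < r} = B_r × B_r × B_r` is `vol(B_r)³`. [folklore] -/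
theorem volume_paramBall {r : ℝ} (hr : 0 < r) :
    volume (ball (0 : Fin 3 → ℝ³) r) = volume (ball (0 : ℝ³) r) ^ 3 := by
  rw [volume_pi_ball _ hr]
  simp [Finset.prod_const, Finset.card_univ]

/-- `0 < vol(Q_r)` for `0 < r`. [folklore] -/
theorem volume_paramBall_ne_zero {r : ℝ} (hr : 0 < r) : volume (ball (0 : Fin 3 → ℝ³) r) ≠ 0 :=
  (measure_ball_pos _ _ hr).ne'

/-- `vol(Q_r) < ∞`. [folklore] -/
theorem volume_paramBall_ne_top (r : ℝ) : volume (ball (0 : Fin 3 → ℝ³) r) ≠ ⊤ :=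
  measure_ball_lt_top.ne

/-- **The averaged field** `A_r f (x) = vol(Q_r)⁻¹ ∫_{Q_r} S_a f(T_a x) da`: the mean over the
parameter ball `Q_r = {‖a‖ < r}` of the conjugates `x ↦ S_a f(T_a x)` of `f` by the linear
deformations `T_a`. [folklore] -/
def average (r : ℝ) (f : ℝ³ → ℝ³) (x : ℝ³) : ℝ³ :=
  ((volume (ball (0 : Fin 3 → ℝ³) r))⁻¹).toReal •
    ∫ a in ball (0 : Fin 3 → ℝ³) r, deformInv a (f (deform a x))

/-- **The average of a DSS field is DSS** (pointwise): if `c f(c x) = f(x)` for all `x` then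
`c (A_r f)(c x) = (A_r f)(x)` for all `x` — each conjugate is DSS (`nsRescaleData_conj`) and the
Bochner integral is linear. [folklore] -/
theorem nsRescaleData_average {f : ℝ³ → ℝ³} {c : ℝ} (hf : nsRescaleData c f = f) (r : ℝ) :
    nsRescaleData c (average r f) = average r f := by
  funext x
  rw [nsRescaleData_apply, average, average, smul_comm, ← integral_smul]
  congr 1
  refine integral_congr_ae (Eventually.of_forall fun a => ?_)
  have h := congrFun (nsRescaleData_conj hf a) x
  rwa [nsRescaleData_apply] at h

/-- Joint (a.e.-strong) measurability of the integrand `(x, a) ↦ S_a f(T_a x)` on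
`ℝ³ × Q_r`, `r ≤ ρ`, for Borel measurable `f`. [folklore] -/
theorem aestronglyMeasurable_conj {f : ℝ³ → ℝ³} (hf : Measurable f) {r : ℝ} (hr : r ≤ radius) :
    AEStronglyMeasurable (fun p : ℝ³ × (Fin 3 → ℝ³) => deformInv p.2 (f (deform p.2 p.1)))
      ((volume : Measure ℝ³).prod (volume.restrict (ball 0 r))) := by
  have hS : AEStronglyMeasurable (fun p : ℝ³ × (Fin 3 → ℝ³) => deformInv p.2)
      ((volume : Measure ℝ³).prod (volume.restrict (ball 0 r))) := by
    have h1 : ContinuousOn (fun p : ℝ³ × (Fin 3 → ℝ³) => deformInv p.2) (univ ×ˢ ball 0 r) :=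
      (continuousOn_deformInv.mono (ball_subset_ball hr)).comp continuousOn_snd fun p hp => hp.2
    have h2 := h1.aestronglyMeasurable (μ := (volume : Measure ℝ³).prod volume)
      (MeasurableSet.univ.prod measurableSet_ball)
    rwa [← Measure.prod_restrict, Measure.restrict_univ] at h2
  have hv : AEStronglyMeasurable (fun p : ℝ³ × (Fin 3 → ℝ³) => f (deform p.2 p.1))
      ((volume : Measure ℝ³).prod (volume.restrict (ball 0 r))) :=
    (hf.comp (continuous_deform_apply₂.comp continuous_swap).measurable).aestronglyMeasurable
  exact isBoundedBilinearMap_apply.continuous.comp_aestronglyMeasurable (hS.prodMk hv)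

/-- The averaged field of a Borel measurable field is a.e.-strongly measurable, `r ≤ ρ`
(Fubini). [folklore] -/
theorem aestronglyMeasurable_average {f : ℝ³ → ℝ³} (hf : Measurable f) {r : ℝ} (hr : r ≤ radius) :
    AEStronglyMeasurable (average r f) volume := by
  show AEStronglyMeasurable (((volume (ball (0 : Fin 3 → ℝ³) r))⁻¹).toReal •
    fun x => ∫ a in ball (0 : Fin 3 → ℝ³) r, deformInv a (f (deform a x))) volume
  exact (MeasureTheory.AEStronglyMeasurable.integral_prod_right'
    (aestronglyMeasurable_conj hf hr)).const_smul _

/-- Measurability of `a ↦ G(T_a x)` in the parameter. [folklore] -/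
theorem measurable_comp_deform_param {G : ℝ³ → ℝ≥0∞} (hG : Measurable G) (x : ℝ³) :
    Measurable fun a : Fin 3 → ℝ³ => G (deform a x) :=
  hG.comp (continuous_deform_apply₂.comp (continuous_id.prodMk continuous_const)).measurable

/-! ### The smoothing estimate: integrability gain by averaging over one column -/

/-- Splitting off the `j₀`-th column of the parameter: the measurable equivalence
`(ℝ³)³ ≃ ℝ³ × (ℝ³)²`, `a ↦ (a_{j₀}, (a_{j₀.succAbove i})ᵢ)`, restricted to the parameter ball, is
measure preserving onto `B_r × (B_r)²`. [folklore] -/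
theorem measurePreserving_split {r : ℝ} (hr : 0 < r) (j₀ : Fin 3) :
    MeasurePreserving (MeasurableEquiv.piFinSuccAbove (fun _ : Fin 3 => ℝ³) j₀)
      (volume.restrict (ball (0 : Fin 3 → ℝ³) r))
      ((volume.restrict (ball (0 : ℝ³) r)).prod (volume.restrict (ball (0 : Fin 2 → ℝ³) r))) := by
  set e := MeasurableEquiv.piFinSuccAbove (fun _ : Fin 3 => ℝ³) j₀
  have hemp : MeasurePreserving e volume volume := volume_preserving_piFinSuccAbove (fun _ => ℝ³) j₀
  have hpre : e ⁻¹' (ball (0 : ℝ³) r ×ˢ ball (0 : Fin 2 → ℝ³) r) = ball 0 r := by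
    ext a
    simp only [mem_preimage, mem_prod, mem_ball_zero_iff]
    rw [pi_norm_lt_iff hr, pi_norm_lt_iff hr, Fin.forall_iff_succAbove j₀]
    rfl
  have h := hemp.restrict_preimage (s := ball (0 : ℝ³) r ×ˢ ball (0 : Fin 2 → ℝ³) r)
    (measurableSet_ball.prod measurableSet_ball)
  rw [hpre] at h
  rwa [Measure.volume_eq_prod, ← Measure.prod_restrict] at h

/-- The deformation with the `j₀`-th column split off:
`T_{(b, c)} x = x_{j₀} b + (x + ∑ᵢ x_{j₀.succAbove i} cᵢ)`. [folklore] -/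
theorem deform_split_symm_apply (j₀ : Fin 3) (b : ℝ³) (c : Fin 2 → ℝ³) (x : ℝ³) :
    deform ((MeasurableEquiv.piFinSuccAbove (fun _ : Fin 3 => ℝ³) j₀).symm (b, c)) x =
      x j₀ • b + (x + ∑ i : Fin 2, x (j₀.succAbove i) • c i) := by
  rw [deform_apply, Fin.sum_univ_succAbove _ j₀]
  have h1 : ∀ j, (MeasurableEquiv.piFinSuccAbove (fun _ : Fin 3 => ℝ³) j₀).symm (b, c) j =
      Fin.insertNth (α := fun _ => ℝ³) j₀ b c j := fun j => rfl
  simp only [h1, Fin.insertNth_apply_same, Fin.insertNth_apply_succAbove]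
  abel

/-- A split parameter `(b, c) ∈ B_r × (B_r)²` reassembles to a parameter in `Q_r`. [folklore] -/
theorem split_symm_mem_ball {r : ℝ} (hr : 0 < r) (j₀ : Fin 3) {b : ℝ³} {c : Fin 2 → ℝ³}
    (hb : b ∈ ball (0 : ℝ³) r) (hc : c ∈ ball (0 : Fin 2 → ℝ³) r) :
    (MeasurableEquiv.piFinSuccAbove (fun _ : Fin 3 => ℝ³) j₀).symm (b, c) ∈
      ball (0 : Fin 3 → ℝ³) r := by
  rw [mem_ball_zero_iff, pi_norm_lt_iff hr, Fin.forall_iff_succAbove j₀]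
  rw [mem_ball_zero_iff] at hb
  rw [mem_ball_zero_iff, pi_norm_lt_iff hr] at hc
  have h1 : ∀ j, (MeasurableEquiv.piFinSuccAbove (fun _ : Fin 3 => ℝ³) j₀).symm (b, c) j =
      Fin.insertNth (α := fun _ => ℝ³) j₀ b c j := fun j => rfl
  simp only [h1, Fin.insertNth_apply_same, Fin.insertNth_apply_succAbove]
  exact ⟨hb, hc⟩

/-- **The one-column substitution.** For `x` with `x_{j₀} ≠ 0`, `0 < r ≤ ρ` and measurable
`G ≥ 0`: `∫_{Q_r} G(T_a x) da ≤ vol(B_r)² |x_{j₀}|⁻³ ∫_{B(0, 2‖x‖)} G`. Indeed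
`T_a x = x_{j₀} a_{j₀} + w` with `w` independent of the column `a_{j₀}`; substitute
`y = x_{j₀} a_{j₀} + w` in the inner integral (Jacobian `|x_{j₀}|⁻³`), where `‖y‖ = ‖T_a x‖ < 2‖x‖`,
and integrate out the other two columns. [folklore] -/
theorem setLIntegral_paramBall_comp_deform_le {G : ℝ³ → ℝ≥0∞} (hG : Measurable G) {r : ℝ}
    (hr0 : 0 < r) (hr : r ≤ radius) {x : ℝ³} (hx : x ≠ 0) {j₀ : Fin 3} (hj : x j₀ ≠ 0) :
    ∫⁻ a in ball (0 : Fin 3 → ℝ³) r, G (deform a x) ≤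
      volume (ball (0 : ℝ³) r) ^ 2 *
        (ENNReal.ofReal |(x j₀ ^ 3)⁻¹| * ∫⁻ y in ball (0 : ℝ³) (2 * ‖x‖), G y) := by
  set e := MeasurableEquiv.piFinSuccAbove (fun _ : Fin 3 => ℝ³) j₀ with he
  set K := ENNReal.ofReal |(x j₀ ^ 3)⁻¹| * ∫⁻ y in ball (0 : ℝ³) (2 * ‖x‖), G y with hK
  have hmp := measurePreserving_split hr0 j₀
  -- transport to the split parameters
  have hmeas : Measurable fun p : ℝ³ × (Fin 2 → ℝ³) => G (deform (e.symm p) x) :=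
    (measurable_comp_deform_param hG x).comp e.symm.measurable
  have hint : ∫⁻ a in ball (0 : Fin 3 → ℝ³) r, G (deform a x) =
      ∫⁻ p, G (deform (e.symm p) x)
        ∂((volume.restrict (ball (0 : ℝ³) r)).prod (volume.restrict (ball (0 : Fin 2 → ℝ³) r))) := by
    rw [← hmp.map_eq, lintegral_map_equiv]
    simp only [he, MeasurableEquiv.symm_apply_apply]
  rw [hint, lintegral_prod_symm _ hmeas.aemeasurable]
  simp only [he, deform_split_symm_apply]
  -- the inner integral over the column `b = a_{j₀}`
  have hinner : ∀ c ∈ ball (0 : Fin 2 → ℝ³) r,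
      ∫⁻ b in ball (0 : ℝ³) r, G (x j₀ • b + (x + ∑ i : Fin 2, x (j₀.succAbove i) • c i)) ≤ K := by
    intro c hc
    set w := x + ∑ i : Fin 2, x (j₀.succAbove i) • c i with hw
    calc ∫⁻ b in ball (0 : ℝ³) r, G (x j₀ • b + w)
        ≤ ∫⁻ b in ball (0 : ℝ³) r, (ball (0 : ℝ³) (2 * ‖x‖)).indicator G (x j₀ • b + w) :=
          setLIntegral_mono' measurableSet_ball fun b hb => by
            have hmem := split_symm_mem_ball hr0 j₀ hb hc
            have hlt := norm_deform_lt_two_mul (lt_of_lt_of_le (mem_ball_zero_iff.1 hmem) hr) hx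
            rw [deform_split_symm_apply] at hlt
            rw [indicator_of_mem (mem_ball_zero_iff.2 hlt)]
      _ ≤ ∫⁻ b, (ball (0 : ℝ³) (2 * ‖x‖)).indicator G (x j₀ • b + w) :=
          setLIntegral_le_lintegral _ _
      _ = ENNReal.ofReal |(x j₀ ^ 3)⁻¹| * ∫⁻ y, (ball (0 : ℝ³) (2 * ‖x‖)).indicator G y := by
          rw [PoincareBall.lintegral_comp_smul_add _ hj, finrank_euclideanSpace_fin]
      _ = K := by rw [lintegral_indicator measurableSet_ball]
  calc ∫⁻ c in ball (0 : Fin 2 → ℝ³) r,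
        ∫⁻ b in ball (0 : ℝ³) r, G (x j₀ • b + (x + ∑ i : Fin 2, x (j₀.succAbove i) • c i))
      ≤ ∫⁻ _ in ball (0 : Fin 2 → ℝ³) r, K := setLIntegral_mono' measurableSet_ball hinner
    _ = volume (ball (0 : ℝ³) r) ^ 2 * K := by
        rw [setLIntegral_const, volume_pi_ball _ hr0, mul_comm]
        simp [Finset.prod_const, Finset.card_univ]

/-- A nonzero vector of `ℝ³` has a coordinate with `‖x‖² ≤ 3 xⱼ²` (the largest one). [folklore] -/
theorem exists_norm_sq_le_three_mul_sq (x : ℝ³) : ∃ j : Fin 3, ‖x‖ ^ 2 ≤ 3 * x j ^ 2 := by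
  by_contra! h
  have hsum : ∑ j : Fin 3, 3 * x j ^ 2 < ∑ _j : Fin 3, ‖x‖ ^ 2 :=
    Finset.sum_lt_sum_of_nonempty Finset.univ_nonempty fun j _ => h j
  rw [EuclideanSpace.norm_sq_eq] at hsum
  simp only [Real.norm_eq_abs, sq_abs, Finset.sum_const, Finset.card_univ, Fintype.card_fin,
    nsmul_eq_mul, ← Finset.mul_sum] at hsum
  norm_num at hsum

/-- A nonzero vector of `ℝ³` has a nonzero coordinate with `‖x‖² ≤ 3 xⱼ²`. [folklore] -/
theorem exists_coord_ne_zero {x : ℝ³} (hx : x ≠ 0) :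
    ∃ j : Fin 3, x j ≠ 0 ∧ ‖x‖ ^ 2 ≤ 3 * x j ^ 2 := by
  obtain ⟨j, hj⟩ := exists_norm_sq_le_three_mul_sq x
  refine ⟨j, fun h0 => ?_, hj⟩
  rw [h0] at hj
  have : ‖x‖ ^ 2 = 0 := le_antisymm (by simpa using hj) (sq_nonneg _)
  exact hx (norm_eq_zero.1 (pow_eq_zero_iff two_ne_zero |>.1 this))

/-- **Pointwise bound for the averaged field**: for `0 < r ≤ ρ`, `x ≠ 0` and a coordinate
`x_{j₀} ≠ 0`, `‖A_r f(x)‖ ≤ 2 vol(B_r)⁻¹ |x_{j₀}|⁻³ ∫_{B(0,2‖x‖)} ‖f‖` (`‖S_a‖ ≤ 2` and the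
one-column substitution). [folklore] -/
theorem enorm_average_le {f : ℝ³ → ℝ³} (hf : Measurable f) {r : ℝ} (hr0 : 0 < r) (hr : r ≤ radius)
    {x : ℝ³} (hx : x ≠ 0) {j₀ : Fin 3} (hj : x j₀ ≠ 0) :
    ‖average r f x‖ₑ ≤ 2 * (volume (ball (0 : ℝ³) r))⁻¹ *
      (ENNReal.ofReal |(x j₀ ^ 3)⁻¹| * ∫⁻ y in ball (0 : ℝ³) (2 * ‖x‖), ‖f y‖ₑ) := by
  set V := volume (ball (0 : ℝ³) r) with hV
  set K := ENNReal.ofReal |(x j₀ ^ 3)⁻¹| * ∫⁻ y in ball (0 : ℝ³) (2 * ‖x‖), ‖f y‖ₑ with hK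
  have hV0 : V ≠ 0 := (measure_ball_pos _ _ hr0).ne'
  have hVtop : V ≠ ⊤ := measure_ball_lt_top.ne
  have hQ0 := volume_paramBall_ne_zero hr0
  rw [average, enorm_smul, Real.enorm_eq_ofReal ENNReal.toReal_nonneg,
    ENNReal.ofReal_toReal (ENNReal.inv_ne_top.2 hQ0), volume_paramBall hr0]
  have h1 : ∫⁻ a in ball (0 : Fin 3 → ℝ³) r, ‖deformInv a (f (deform a x))‖ₑ ≤
      2 * ∫⁻ a in ball (0 : Fin 3 → ℝ³) r, ‖f (deform a x)‖ₑ := by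
    rw [← lintegral_const_mul' _ _ ENNReal.ofNat_ne_top]
    exact setLIntegral_mono' measurableSet_ball fun a ha =>
      enorm_deformInv_le (lt_of_lt_of_le (mem_ball_zero_iff.1 ha) hr) _
  have h2 := setLIntegral_paramBall_comp_deform_le (G := fun y => ‖f y‖ₑ) hf.enorm hr0 hr hx hj
  calc (V ^ 3)⁻¹ * ‖∫ a in ball (0 : Fin 3 → ℝ³) r, deformInv a (f (deform a x))‖ₑ
      ≤ (V ^ 3)⁻¹ * (2 * (V ^ 2 * K)) := by
        gcongr
        exact (enorm_integral_le_lintegral_enorm _).trans (h1.trans (by gcongr))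
    _ = (V⁻¹ * ((V ^ 2)⁻¹ * V ^ 2)) * (2 * K) := by
        rw [pow_succ, ENNReal.mul_inv (Or.inl (pow_ne_zero 2 hV0)) (Or.inl (ENNReal.pow_ne_top hVtop))]
        ring
    _ = 2 * V⁻¹ * K := by
        rw [ENNReal.inv_mul_cancel (pow_ne_zero 2 hV0) (ENNReal.pow_ne_top hVtop), mul_one]
        ring


/-! ### Weak divergence-freeness of the averaged field (Fubini) -/

/-- Finiteness of `∫_B ‖f‖` on balls for a locally integrable field. [folklore] -/
theorem setLIntegral_ball_enorm_lt_top {f : ℝ³ → ℝ³} (hfi : LocallyIntegrable f volume) (R : ℝ) :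
    ∫⁻ y in ball (0 : ℝ³) R, ‖f y‖ₑ < ⊤ :=
  ((hfi.integrableOn_isCompact (isCompact_closedBall (0 : ℝ³) R)).mono_set
    ball_subset_closedBall).2

/-- For `x ≠ 0` and `0 < r ≤ ρ`, the conjugates `a ↦ S_a f(T_a x)` are integrable over the
parameter ball (the one-column substitution bounds `∫_{Q_r} ‖f(T_a x)‖ da` by a local `L¹` norm
of `f`). [folklore] -/
theorem integrableOn_conj_param {f : ℝ³ → ℝ³} (hf : Measurable f) (hfi : LocallyIntegrable f volume)
    {r : ℝ} (hr0 : 0 < r) (hr : r ≤ radius) {x : ℝ³} (hx : x ≠ 0) :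
    Integrable (fun a => deformInv a (f (deform a x))) (volume.restrict (ball (0 : Fin 3 → ℝ³) r)) := by
  obtain ⟨j₀, hj, -⟩ := exists_coord_ne_zero hx
  refine ⟨?_, ?_⟩
  · have hS : AEStronglyMeasurable deformInv (volume.restrict (ball (0 : Fin 3 → ℝ³) r)) :=
      (continuousOn_deformInv.mono (ball_subset_ball hr)).aestronglyMeasurable measurableSet_ball
    have hv : AEStronglyMeasurable (fun a => f (deform a x))
        (volume.restrict (ball (0 : Fin 3 → ℝ³) r)) :=
      (hf.comp (continuous_deform_apply₂.comp
        (continuous_id.prodMk continuous_const)).measurable).aestronglyMeasurable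
    exact isBoundedBilinearMap_apply.continuous.comp_aestronglyMeasurable (hS.prodMk hv)
  · rw [hasFiniteIntegral_iff_enorm]
    calc ∫⁻ a in ball (0 : Fin 3 → ℝ³) r, ‖deformInv a (f (deform a x))‖ₑ
        ≤ ∫⁻ a in ball (0 : Fin 3 → ℝ³) r, 2 * ‖f (deform a x)‖ₑ :=
          setLIntegral_mono' measurableSet_ball fun a ha =>
            enorm_deformInv_le (lt_of_lt_of_le (mem_ball_zero_iff.1 ha) hr) _
      _ = 2 * ∫⁻ a in ball (0 : Fin 3 → ℝ³) r, ‖f (deform a x)‖ₑ :=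
          lintegral_const_mul' _ _ ENNReal.ofNat_ne_top
      _ ≤ 2 * (volume (ball (0 : ℝ³) r) ^ 2 *
          (ENNReal.ofReal |(x j₀ ^ 3)⁻¹| * ∫⁻ y in ball (0 : ℝ³) (2 * ‖x‖), ‖f y‖ₑ)) := by
          gcongr
          exact setLIntegral_paramBall_comp_deform_le hf.enorm hr0 hr hx hj
      _ < ⊤ := ENNReal.mul_lt_top ENNReal.ofNat_lt_top (ENNReal.mul_lt_top
          (ENNReal.pow_lt_top measure_ball_lt_top) (ENNReal.mul_lt_top ENNReal.ofReal_lt_top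
            (setLIntegral_ball_enorm_lt_top hfi _)))

/-- **Integrability on `ℝ³ × Q_r` against a test gradient.** For a locally integrable Borel field
`f`, `0 < r ≤ ρ` and a test function `θ`, `(x, a) ↦ ⟪S_a f(T_a x), ∇θ(x)⟫` is integrable on
`ℝ³ × Q_r`: `|⟪S_a f(T_a x), ∇θ x⟫| ≤ 2 ‖∇θ‖_∞ 1_K(x) ‖f(T_a x)‖` with `K = tsupport θ ⊆ B̄(0,R)`,
and `∫ 1_K(x)‖f(T_a x)‖ dx ≤ 2 ∫_{B̄(0,2R)} ‖f‖` by the substitution `y = T_a x`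
(`‖y‖ ≤ (3/2)‖S_a y‖`). [folklore] -/
theorem integrable_inner_conj_gradient {f : ℝ³ → ℝ³} (hf : Measurable f)
    (hfi : LocallyIntegrable f volume) {r : ℝ} (hr : r ≤ radius) {θ : ℝ³ → ℝ}
    (hθ : FunctionSpaces.IsTestFunctionOn (⊤ : TopologicalSpace.Opens ℝ³) θ) :
    Integrable (fun p : ℝ³ × (Fin 3 → ℝ³) => ⟪deformInv p.2 (f (deform p.2 p.1)), gradient θ p.1⟫)
      ((volume : Measure ℝ³).prod (volume.restrict (ball 0 r))) := by
  set μ := (volume : Measure ℝ³).prod (volume.restrict (ball (0 : Fin 3 → ℝ³) r)) with hμ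
  -- the gradient: continuous, supported in `K = tsupport θ ⊆ closedBall 0 R`, bounded by `M`
  have hgc : Continuous (gradient θ) :=
    (InnerProductSpace.toDual ℝ ℝ³).symm.continuous.comp (hθ.contDiff.continuous_fderiv (by simp))
  set K := tsupport θ with hK
  have hKc : IsCompact K := hθ.hasCompactSupport
  obtain ⟨R, hR0, hR⟩ := hKc.isBounded.subset_closedBall_lt 0 0
  have hgradK : ∀ x, x ∉ K → gradient θ x = 0 := by
    intro x hx
    have h1 : fderiv ℝ θ x = 0 := fderiv_of_notMem_tsupport ℝ hx
    simp [gradient, h1]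
  obtain ⟨M, hM⟩ := (hθ.hasCompactSupport.fderiv (𝕜 := ℝ)).comp_left
    (g := (InnerProductSpace.toDual ℝ ℝ³).symm) (map_zero _) |>.exists_bound_of_continuous hgc
  have hM0 : 0 ≤ M := (norm_nonneg _).trans (hM 0)
  -- measurability
  have hsm : AEStronglyMeasurable
      (fun p : ℝ³ × (Fin 3 → ℝ³) => ⟪deformInv p.2 (f (deform p.2 p.1)), gradient θ p.1⟫) μ :=
    (aestronglyMeasurable_conj hf hr).inner (hgc.comp_aestronglyMeasurable
      (measurable_fst.aestronglyMeasurable))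
  refine ⟨hsm, ?_⟩
  rw [hasFiniteIntegral_iff_enorm]
  -- pointwise domination
  have hdom : ∀ p : ℝ³ × (Fin 3 → ℝ³), p.2 ∈ ball (0 : Fin 3 → ℝ³) r →
      ‖⟪deformInv p.2 (f (deform p.2 p.1)), gradient θ p.1⟫‖ₑ ≤
        (2 * ENNReal.ofReal M) * (K.indicator 1 p.1 * ‖f (deform p.2 p.1)‖ₑ) := by
    intro p hp
    have ha : ‖p.2‖ < radius := lt_of_lt_of_le (mem_ball_zero_iff.1 hp) hr
    by_cases hxK : p.1 ∈ K
    · rw [indicator_of_mem hxK, Pi.one_apply, one_mul]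
      calc ‖⟪deformInv p.2 (f (deform p.2 p.1)), gradient θ p.1⟫‖ₑ
          = ENNReal.ofReal |⟪deformInv p.2 (f (deform p.2 p.1)), gradient θ p.1⟫| := by
            rw [← Real.norm_eq_abs, ofReal_norm]
        _ ≤ ENNReal.ofReal ((2 * ‖f (deform p.2 p.1)‖) * M) := by
            refine ENNReal.ofReal_le_ofReal ((abs_real_inner_le_norm _ _).trans ?_)
            exact mul_le_mul (norm_deformInv_le ha _) (hM _) (norm_nonneg _)
              (by positivity)
        _ = (2 * ENNReal.ofReal M) * ‖f (deform p.2 p.1)‖ₑ := by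
            rw [ENNReal.ofReal_mul (by positivity), ENNReal.ofReal_mul zero_le_two,
              ENNReal.ofReal_ofNat, ofReal_norm]
            ring
    · rw [hgradK _ hxK, inner_zero_right, enorm_zero]
      exact zero_le
  have hdom' : ∀ᵐ p ∂μ, ‖⟪deformInv p.2 (f (deform p.2 p.1)), gradient θ p.1⟫‖ₑ ≤
      (2 * ENNReal.ofReal M) * (K.indicator 1 p.1 * ‖f (deform p.2 p.1)‖ₑ) := by
    have h1 : ∀ᵐ p ∂μ, p.2 ∈ ball (0 : Fin 3 → ℝ³) r := by
      rw [hμ, ← Measure.restrict_univ (μ := (volume : Measure ℝ³)), Measure.prod_restrict]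
      filter_upwards [ae_restrict_mem (MeasurableSet.univ.prod measurableSet_ball)] with p hp
      exact hp.2
    filter_upwards [h1] with p hp using hdom p hp
  -- the dominating integral, by Tonelli and the substitution `y = T_a x`
  have hKm : MeasurableSet K := hKc.measurableSet
  have hmeasG : Measurable fun p : ℝ³ × (Fin 3 → ℝ³) => K.indicator 1 p.1 * ‖f (deform p.2 p.1)‖ₑ :=
    ((measurable_one.indicator hKm).comp measurable_fst).mul
      (hf.comp (continuous_deform_apply₂.comp continuous_swap).measurable).enorm
  have hslice : ∀ a ∈ ball (0 : Fin 3 → ℝ³) r,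
      ∫⁻ x, K.indicator 1 x * ‖f (deform a x)‖ₑ ≤ 2 * ∫⁻ y in closedBall (0 : ℝ³) (2 * R), ‖f y‖ₑ := by
    intro a ha
    have ha' : ‖a‖ < radius := lt_of_lt_of_le (mem_ball_zero_iff.1 ha) hr
    have heq : (fun x => K.indicator (1 : ℝ³ → ℝ≥0∞) x * ‖f (deform a x)‖ₑ) =
        fun x => (fun y => K.indicator (1 : ℝ³ → ℝ≥0∞) (deformInv a y) * ‖f y‖ₑ) (deform a x) := by
      funext x
      simp only [deformInv_deform ha']
    rw [heq]
    refine (lintegral_comp_deform_le ha'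
      (fun y => K.indicator (1 : ℝ³ → ℝ≥0∞) (deformInv a y) * ‖f y‖ₑ)).trans ?_
    refine mul_le_mul_right ?_ _
    rw [← lintegral_indicator measurableSet_closedBall]
    refine lintegral_mono fun y => ?_
    by_cases hy : deformInv a y ∈ K
    · have hy' : y ∈ closedBall (0 : ℝ³) (2 * R) := by
        rw [mem_closedBall, dist_zero_right]
        have h1 := hR hy
        rw [mem_closedBall, dist_zero_right] at h1
        have h2 := norm_deform_le ha' (deformInv a y)
        rw [deform_deformInv ha'] at h2
        linarith
      rw [indicator_of_mem hy, indicator_of_mem hy', Pi.one_apply, one_mul]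
    · rw [indicator_of_notMem hy, zero_mul]
      exact zero_le
  calc ∫⁻ p, ‖⟪deformInv p.2 (f (deform p.2 p.1)), gradient θ p.1⟫‖ₑ ∂μ
      ≤ ∫⁻ p, (2 * ENNReal.ofReal M) * (K.indicator 1 p.1 * ‖f (deform p.2 p.1)‖ₑ) ∂μ :=
        lintegral_mono_ae hdom'
    _ = (2 * ENNReal.ofReal M) * ∫⁻ a in ball (0 : Fin 3 → ℝ³) r,
          ∫⁻ x, K.indicator 1 x * ‖f (deform a x)‖ₑ := by
        rw [lintegral_const_mul _ hmeasG, hμ, lintegral_prod_symm _ hmeasG.aemeasurable]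
    _ ≤ (2 * ENNReal.ofReal M) * ∫⁻ _ in ball (0 : Fin 3 → ℝ³) r,
          2 * ∫⁻ y in closedBall (0 : ℝ³) (2 * R), ‖f y‖ₑ := by
        exact mul_le_mul_right (setLIntegral_mono' measurableSet_ball hslice) _
    _ < ⊤ := by
        rw [setLIntegral_const]
        refine ENNReal.mul_lt_top (ENNReal.mul_lt_top ENNReal.ofNat_lt_top ENNReal.ofReal_lt_top)
          (ENNReal.mul_lt_top (ENNReal.mul_lt_top ENNReal.ofNat_lt_top ?_) measure_ball_lt_top)
        exact ((hfi.integrableOn_isCompact (isCompact_closedBall (0 : ℝ³) (2 * R)))).2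

/-- **The averaged field is weakly divergence free.** For a locally integrable, Borel measurable,
weakly divergence-free field `f` and `0 < r ≤ ρ`: `∫ ⟪A_r f, ∇θ⟫ = 0` for every test function
`θ`. Proof: `⟪A_r f(x), ∇θ(x)⟫ = vol(Q_r)⁻¹ ∫_{Q_r} ⟪S_a f(T_a x), ∇θ(x)⟫ da` for `x ≠ 0`; swap the
integrals (Fubini, `integrable_inner_conj_gradient`) and use that each conjugate is weakly
divergence free (`isWeaklyDivFree_conj`). [folklore] -/
theorem isWeaklyDivFree_average {f : ℝ³ → ℝ³} (hf : Measurable f) (hfi : LocallyIntegrable f volume)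
    (hdiv : IsWeaklyDivFree f) {r : ℝ} (hr0 : 0 < r) (hr : r ≤ radius) :
    IsWeaklyDivFree (average r f) := by
  intro θ hθ
  set Q := ball (0 : Fin 3 → ℝ³) r with hQ
  set κ : ℝ := ((volume Q)⁻¹).toReal with hκ
  have hpt : ∀ x : ℝ³, x ≠ 0 → ⟪average r f x, gradient θ x⟫ =
      κ * ∫ a in Q, ⟪deformInv a (f (deform a x)), gradient θ x⟫ := by
    intro x hx
    rw [average, real_inner_smul_left, real_inner_comm,
      ← integral_inner (integrableOn_conj_param hf hfi hr0 hr hx)]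
    congr 1
    exact integral_congr_ae (Eventually.of_forall fun a => real_inner_comm _ _)
  have hae : (fun x => ⟪average r f x, gradient θ x⟫) =ᵐ[volume]
      fun x => κ * ∫ a in Q, ⟪deformInv a (f (deform a x)), gradient θ x⟫ := by
    have h0 : ∀ᵐ x ∂(volume : Measure ℝ³), x ≠ 0 :=
      compl_mem_ae_iff.2 (measure_singleton (0 : ℝ³))
    filter_upwards [h0] with x hx using hpt x hx
  rw [integral_congr_ae hae, integral_const_mul]
  have hswap := integral_integral_swap
    (f := fun x a => ⟪deformInv a (f (deform a x)), gradient θ x⟫)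
    (by exact integrable_inner_conj_gradient hf hfi hr hθ)
  rw [hswap]
  have hzero : ∀ a ∈ Q, ∫ x, ⟪deformInv a (f (deform a x)), gradient θ x⟫ = 0 := fun a ha =>
    isWeaklyDivFree_conj hdiv (lt_of_lt_of_le (mem_ball_zero_iff.1 ha) hr) θ hθ
  rw [setIntegral_congr_fun measurableSet_ball hzero, integral_zero, mul_zero]


/-! ### Convergence of the averages in `L²(B₁)` -/

/-- **Uniform convergence of the conjugates of a continuous compactly supported field**: for
`h ∈ C_c(ℝ³; ℝ³)` and `γ > 0` there is `δ ∈ (0, ρ]` with `‖S_a h(T_a x) − h(x)‖ ≤ γ` for all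
`‖a‖ < δ`, `‖x‖ ≤ 1` (uniform continuity of `h`, `‖T_a x − x‖ ≤ 3‖a‖` on `B₁`, and `S_a → 1`). [folklore] -/
theorem exists_forall_norm_conj_sub_le {h : ℝ³ → ℝ³} (hc : Continuous h) (hs : HasCompactSupport h)
    {γ : ℝ} (hγ : 0 < γ) : ∃ δ > 0, δ ≤ radius ∧ ∀ a : Fin 3 → ℝ³, ‖a‖ < δ → ∀ x : ℝ³, ‖x‖ ≤ 1 →
      ‖deformInv a (h (deform a x)) - h x‖ ≤ γ := by
  obtain ⟨M, hM⟩ := hs.exists_bound_of_continuous hc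
  have hM0 : 0 ≤ M := (norm_nonneg _).trans (hM 0)
  obtain ⟨δ₁, hδ₁, hu⟩ := Metric.uniformContinuous_iff.1 (hs.uniformContinuous_of_continuous hc)
    (γ / 4) (by positivity)
  obtain ⟨δ₂, hδ₂, hS⟩ := Metric.tendsto_nhds_nhds.1 tendsto_deformInv_zero (γ / (2 * (M + 1)))
    (by positivity)
  refine ⟨min radius (min (δ₁ / 3) δ₂), lt_min radius_pos (lt_min (by positivity) hδ₂),
    min_le_left _ _, fun a ha x hx => ?_⟩
  have har : ‖a‖ < radius := lt_of_lt_of_le ha (min_le_left _ _)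
  have ha1 : ‖a‖ < δ₁ / 3 := lt_of_lt_of_le ha ((min_le_right _ _).trans (min_le_left _ _))
  have ha2 : ‖a‖ < δ₂ := lt_of_lt_of_le ha ((min_le_right _ _).trans (min_le_right _ _))
  have hT : dist (deform a x) x < δ₁ := by
    rw [dist_eq_norm]
    calc ‖deform a x - x‖ ≤ 3 * ‖a‖ * ‖x‖ := norm_deform_sub_self_le a x
      _ ≤ 3 * ‖a‖ * 1 := by gcongr
      _ < δ₁ := by linarith
  have h1 : ‖h (deform a x) - h x‖ < γ / 4 := by
    rw [← dist_eq_norm]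
    exact hu hT
  have hS' : ‖deformInv a - ContinuousLinearMap.id ℝ ℝ³‖ < γ / (2 * (M + 1)) := by
    have h2 := hS (x := a) (by simpa [dist_zero_right] using ha2)
    rwa [dist_eq_norm] at h2
  have hdecomp : deformInv a (h (deform a x)) - h x =
      deformInv a (h (deform a x) - h x) + (deformInv a - ContinuousLinearMap.id ℝ ℝ³) (h x) := by
    rw [map_sub]
    show _ = _ + (deformInv a (h x) - h x)
    abel
  calc ‖deformInv a (h (deform a x)) - h x‖
      ≤ ‖deformInv a (h (deform a x) - h x)‖ + ‖(deformInv a - ContinuousLinearMap.id ℝ ℝ³) (h x)‖ := by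
        rw [hdecomp]
        exact norm_add_le _ _
    _ ≤ 2 * ‖h (deform a x) - h x‖ + ‖deformInv a - ContinuousLinearMap.id ℝ ℝ³‖ * ‖h x‖ :=
        add_le_add (norm_deformInv_le har _) (ContinuousLinearMap.le_opNorm _ _)
    _ ≤ 2 * (γ / 4) + γ / (2 * (M + 1)) * M := by
        gcongr
        exact hM x
    _ ≤ γ := by
        have h3 : γ / (2 * (M + 1)) * M ≤ γ / 2 := by
          rw [div_mul_eq_mul_div, div_le_div_iff₀ (by positivity) (by positivity)]
          nlinarith
        linarith

/-- `(A^{1/2})² = A` in `ℝ≥0∞`. [folklore] -/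
theorem rpow_inv_two_sq (A : ℝ≥0∞) : (A ^ (2⁻¹ : ℝ)) ^ 2 = A := by
  rw [← ENNReal.rpow_natCast, ← ENNReal.rpow_mul]
  norm_num

/-- **Continuity of the linear deformations on `L²_loc` at the identity**: if `f` is Borel
measurable with `∫_{B₃} ‖f‖² < ∞`, then for every `ε > 0` there is `δ ∈ (0, ρ]` with
`∫_{B₁} ‖S_a f(T_a x) − f(x)‖² dx ≤ ε` for all `‖a‖ < δ`. Proof: approximate `f 1_{B₃}` in `L²` by a
continuous compactly supported `h` (Mathlib's `MemLp.exists_hasCompactSupport_eLpNorm_sub_le`);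
the error terms are controlled by the substitution `y = T_a x` (Jacobian `≤ 2`, `‖S_a‖ ≤ 2`) and
the middle term by `exists_forall_norm_conj_sub_le`. [folklore] -/
theorem exists_forall_setLIntegral_conj_sub_sq_le {f : ℝ³ → ℝ³} (hf : Measurable f)
    (h2 : ∫⁻ x in ball (0 : ℝ³) 3, ‖f x‖ₑ ^ 2 < ⊤) {ε : ℝ≥0∞} (hε : 0 < ε) :
    ∃ δ > 0, δ ≤ radius ∧ ∀ a : Fin 3 → ℝ³, ‖a‖ < δ →
      ∫⁻ x in ball (0 : ℝ³) 1, ‖deformInv a (f (deform a x)) - f x‖ₑ ^ 2 ≤ ε := by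
  rcases eq_or_ne ε ⊤ with rfl | hεtop
  · exact ⟨radius, radius_pos, le_rfl, fun a _ => le_top⟩
  -- constants
  set V₁ := volume (ball (0 : ℝ³) 1) with hV₁
  have hV₁0 : V₁ ≠ 0 := (measure_ball_pos _ _ one_pos).ne'
  have hV₁top : V₁ ≠ ⊤ := measure_ball_lt_top.ne
  set η : ℝ≥0∞ := min 1 (ε / 2 / 20) with hη
  have hη0 : η ≠ 0 := (lt_min one_pos (ENNReal.div_pos
    (ENNReal.div_pos hε.ne' ENNReal.ofNat_ne_top).ne' ENNReal.ofNat_ne_top)).ne'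
  have hη1 : η ≤ 1 := min_le_left _ _
  have hηε : 20 * η ≤ ε / 2 :=
    (mul_le_mul_right (min_le_right _ _) _).trans_eq (ENNReal.mul_div_cancel (by norm_num) (by simp))
  set q : ℝ≥0∞ := ε / 2 / (4 * V₁) with hq
  have hqtop : q ≠ ⊤ := ENNReal.div_ne_top (ENNReal.div_ne_top hεtop two_ne_zero)
    (mul_ne_zero four_ne_zero hV₁0)
  have hq0 : q ≠ 0 := (ENNReal.div_pos (ENNReal.div_pos hε.ne' ENNReal.ofNat_ne_top).ne'
    (ENNReal.mul_ne_top ENNReal.ofNat_ne_top hV₁top)).ne'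
  set γ : ℝ := Real.sqrt q.toReal with hγ
  have hγ0 : 0 < γ := Real.sqrt_pos.2 (ENNReal.toReal_pos hq0 hqtop)
  have hγq : ENNReal.ofReal (γ ^ 2) = q := by
    rw [hγ, Real.sq_sqrt ENNReal.toReal_nonneg, ENNReal.ofReal_toReal hqtop]
  have hγε : 4 * (ENNReal.ofReal (γ ^ 2) * V₁) ≤ ε / 2 := by
    rw [hγq, ← mul_assoc, mul_comm 4 q, mul_assoc, hq,
      ENNReal.div_mul_cancel (mul_ne_zero four_ne_zero hV₁0) (ENNReal.mul_ne_top ENNReal.ofNat_ne_top hV₁top)]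
  -- `f 1_{B₃} ∈ L²` and its continuous compactly supported approximation `h`
  set f₃ := (ball (0 : ℝ³) 3).indicator f with hf₃
  have hf₃m : Measurable f₃ := hf.indicator measurableSet_ball
  have hf₃L : MemLp f₃ 2 volume := by
    rw [hf₃, memLp_indicator_iff_restrict measurableSet_ball]
    refine ⟨hf.aestronglyMeasurable, ?_⟩
    rw [eLpNorm_lt_top_iff_lintegral_rpow_enorm_lt_top two_ne_zero ENNReal.ofNat_ne_top]
    simpa [ENNReal.rpow_two] using h2
  obtain ⟨h, hhs, hfh, hhc, -⟩ :=
    hf₃L.exists_hasCompactSupport_eLpNorm_sub_le ENNReal.ofNat_ne_top hη0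
  have hfh2 : ∫⁻ x, ‖f₃ x - h x‖ₑ ^ 2 ≤ η := by
    have e1 : ∫⁻ x, ‖f₃ x - h x‖ₑ ^ 2 = eLpNorm (f₃ - h) 2 volume ^ 2 := by
      have h3 := eLpNorm_nnreal_pow_eq_lintegral (f := f₃ - h) (p := (2 : ℝ≥0))
        (μ := (volume : Measure ℝ³)) two_ne_zero
      simp only [ENNReal.coe_ofNat, NNReal.coe_ofNat, ENNReal.rpow_two, Pi.sub_apply] at h3
      exact h3.symm
    calc ∫⁻ x, ‖f₃ x - h x‖ₑ ^ 2 = eLpNorm (f₃ - h) 2 volume ^ 2 := e1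
      _ ≤ η ^ 2 := by gcongr
      _ ≤ η := by
          rw [sq]
          exact mul_le_of_le_one_left (zero_le) hη1
  -- the uniform term
  obtain ⟨δ, hδ, hδr, hunif⟩ := exists_forall_norm_conj_sub_le hhc hhs hγ0
  refine ⟨δ, hδ, hδr, fun a ha => ?_⟩
  have har : ‖a‖ < radius := lt_of_lt_of_le ha hδr
  set S := deformInv a with hS
  set T := deform a with hT
  -- on `B₁` the field and its deformation see only `f 1_{B₃}`
  have hcongr : ∫⁻ x in ball (0 : ℝ³) 1, ‖S (f (T x)) - f x‖ₑ ^ 2 =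
      ∫⁻ x in ball (0 : ℝ³) 1, ‖S (f₃ (T x)) - f₃ x‖ₑ ^ 2 := by
    refine setLIntegral_congr_fun measurableSet_ball fun x hx => ?_
    have hx3 : x ∈ ball (0 : ℝ³) 3 := ball_subset_ball (by norm_num) hx
    have hTx3 : T x ∈ ball (0 : ℝ³) 3 := by
      rw [mem_ball_zero_iff] at hx ⊢
      have := norm_deform_le har x
      rw [← hT] at this
      linarith
    rw [hf₃, indicator_of_mem hx3, indicator_of_mem hTx3]
  rw [hcongr]
  -- pointwise three-term bound
  have hpt : ∀ x, ‖S (f₃ (T x)) - f₃ x‖ₑ ^ 2 ≤ 2 * ‖S ((f₃ - h) (T x))‖ₑ ^ 2 +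
      (4 * ‖S (h (T x)) - h x‖ₑ ^ 2 + 4 * ‖f₃ x - h x‖ₑ ^ 2) := by
    intro x
    have i1 := BradshawTsai2019.enorm_sq_le_two_mul_sub_sq_add (S (f₃ (T x)) - f₃ x)
      (S (h (T x)) - f₃ x)
    have i2 := BradshawTsai2019.enorm_sq_le_two_mul_sub_sq_add (S (h (T x)) - f₃ x) (h x - f₃ x)
    rw [sub_sub_sub_cancel_right] at i1 i2
    rw [← map_sub] at i1
    have e3 : ‖h x - f₃ x‖ₑ = ‖f₃ x - h x‖ₑ := by rw [← neg_sub, enorm_neg]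
    rw [e3] at i2
    calc ‖S (f₃ (T x)) - f₃ x‖ₑ ^ 2
        ≤ 2 * ‖S (f₃ (T x) - h (T x))‖ₑ ^ 2 + 2 * ‖S (h (T x)) - f₃ x‖ₑ ^ 2 := i1
      _ ≤ 2 * ‖S (f₃ (T x) - h (T x))‖ₑ ^ 2 +
          2 * (2 * ‖S (h (T x)) - h x‖ₑ ^ 2 + 2 * ‖f₃ x - h x‖ₑ ^ 2) := by gcongr
      _ = _ := by rw [Pi.sub_apply]; ring
  -- measurability of the three pieces
  have hTm : Measurable T := T.continuous.measurable
  have hP1 : Measurable fun x => ‖S ((f₃ - h) (T x))‖ₑ ^ 2 :=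
    (S.continuous.measurable.comp ((hf₃m.sub hhc.measurable).comp hTm)).enorm.pow_const 2
  have hP2 : Measurable fun x => ‖S (h (T x)) - h x‖ₑ ^ 2 :=
    ((S.continuous.measurable.comp (hhc.measurable.comp hTm)).sub hhc.measurable).enorm.pow_const 2
  have hP3 : Measurable fun x => ‖f₃ x - h x‖ₑ ^ 2 := (hf₃m.sub hhc.measurable).enorm.pow_const 2
  -- the three integrals
  have hI1 : ∫⁻ x in ball (0 : ℝ³) 1, ‖S ((f₃ - h) (T x))‖ₑ ^ 2 ≤ 8 * η := by
    calc ∫⁻ x in ball (0 : ℝ³) 1, ‖S ((f₃ - h) (T x))‖ₑ ^ 2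
        ≤ ∫⁻ x, ‖S ((f₃ - h) (T x))‖ₑ ^ 2 := setLIntegral_le_lintegral _ _
      _ ≤ ∫⁻ x, 4 * ‖(f₃ - h) (T x)‖ₑ ^ 2 := lintegral_mono fun x => by
          calc ‖S ((f₃ - h) (T x))‖ₑ ^ 2 ≤ (2 * ‖(f₃ - h) (T x)‖ₑ) ^ 2 := by
                gcongr
                exact enorm_deformInv_le har _
            _ = 4 * ‖(f₃ - h) (T x)‖ₑ ^ 2 := by ring
      _ = 4 * ∫⁻ x, (fun y => ‖(f₃ - h) y‖ₑ ^ 2) (T x) :=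
          lintegral_const_mul _ (((hf₃m.sub hhc.measurable).comp hTm).enorm.pow_const 2)
      _ ≤ 4 * (2 * ∫⁻ y, ‖(f₃ - h) y‖ₑ ^ 2) := by
          gcongr
          exact lintegral_comp_deform_le har _
      _ ≤ 4 * (2 * η) := by
          gcongr
          simpa only [Pi.sub_apply] using hfh2
      _ = 8 * η := by ring
  have hI2 : ∫⁻ x in ball (0 : ℝ³) 1, ‖S (h (T x)) - h x‖ₑ ^ 2 ≤ ENNReal.ofReal (γ ^ 2) * V₁ := by
    calc ∫⁻ x in ball (0 : ℝ³) 1, ‖S (h (T x)) - h x‖ₑ ^ 2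
        ≤ ∫⁻ _ in ball (0 : ℝ³) 1, ENNReal.ofReal (γ ^ 2) :=
          setLIntegral_mono' measurableSet_ball fun x hx => by
            have h4 := hunif a ha x (mem_ball_zero_iff.1 hx).le
            calc ‖S (h (T x)) - h x‖ₑ ^ 2 = ENNReal.ofReal (‖S (h (T x)) - h x‖ ^ 2) := by
                  rw [ENNReal.ofReal_pow (norm_nonneg _), ofReal_norm]
              _ ≤ ENNReal.ofReal (γ ^ 2) :=
                  ENNReal.ofReal_le_ofReal (pow_le_pow_left₀ (norm_nonneg _) h4 2)
      _ = ENNReal.ofReal (γ ^ 2) * V₁ := setLIntegral_const _ _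
  have hI3 : ∫⁻ x in ball (0 : ℝ³) 1, ‖f₃ x - h x‖ₑ ^ 2 ≤ η :=
    (setLIntegral_le_lintegral _ _).trans hfh2
  -- conclusion
  calc ∫⁻ x in ball (0 : ℝ³) 1, ‖S (f₃ (T x)) - f₃ x‖ₑ ^ 2
      ≤ ∫⁻ x in ball (0 : ℝ³) 1, (2 * ‖S ((f₃ - h) (T x))‖ₑ ^ 2 +
          (4 * ‖S (h (T x)) - h x‖ₑ ^ 2 + 4 * ‖f₃ x - h x‖ₑ ^ 2)) := lintegral_mono fun x => hpt x
    _ = 2 * (∫⁻ x in ball (0 : ℝ³) 1, ‖S ((f₃ - h) (T x))‖ₑ ^ 2) +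
          (4 * (∫⁻ x in ball (0 : ℝ³) 1, ‖S (h (T x)) - h x‖ₑ ^ 2) +
            4 * (∫⁻ x in ball (0 : ℝ³) 1, ‖f₃ x - h x‖ₑ ^ 2)) := by
        rw [lintegral_add_left (hP1.const_mul 2), lintegral_add_left (hP2.const_mul 4),
          lintegral_const_mul _ hP1, lintegral_const_mul _ hP2, lintegral_const_mul _ hP3]
    _ ≤ 2 * (8 * η) + (4 * (ENNReal.ofReal (γ ^ 2) * V₁) + 4 * η) :=
        add_le_add (mul_le_mul_right hI1 _)
          (add_le_add (mul_le_mul_right hI2 _) (mul_le_mul_right hI3 _))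
    _ = 20 * η + 4 * (ENNReal.ofReal (γ ^ 2) * V₁) := by ring
    _ ≤ ε / 2 + ε / 2 := add_le_add hηε hγε
    _ = ε := ENNReal.add_halves ε

/-- **From the conjugates to the average (Jensen and Tonelli).** If
`∫_{B₁} ‖S_a f(T_a x) − f(x)‖² dx ≤ ε` for all `‖a‖ < r` (`0 < r ≤ ρ`), then
`∫_{B₁} ‖A_r f − f‖² ≤ ε`: for `x ≠ 0`, `A_r f(x) − f(x) = vol(Q_r)⁻¹ ∫_{Q_r} (S_a f(T_a x) − f(x)) da`,
so `‖A_r f(x) − f(x)‖² ≤ vol(Q_r)⁻¹ ∫_{Q_r} ‖S_a f(T_a x) − f(x)‖² da` (Cauchy–Schwarz); integrate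
over `B₁` and exchange the integrals. [folklore] -/
theorem setLIntegral_average_sub_sq_le {f : ℝ³ → ℝ³} (hf : Measurable f)
    (hfi : LocallyIntegrable f volume) {r : ℝ} (hr0 : 0 < r) (hr : r ≤ radius) {ε : ℝ≥0∞}
    (hD : ∀ a : Fin 3 → ℝ³, ‖a‖ < r →
      ∫⁻ x in ball (0 : ℝ³) 1, ‖deformInv a (f (deform a x)) - f x‖ₑ ^ 2 ≤ ε) :
    ∫⁻ x in ball (0 : ℝ³) 1, ‖average r f x - f x‖ₑ ^ 2 ≤ ε := by
  set Q := ball (0 : Fin 3 → ℝ³) r with hQ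
  set V := volume Q with hV
  have hV0 : V ≠ 0 := volume_paramBall_ne_zero hr0
  have hVtop : V ≠ ⊤ := volume_paramBall_ne_top r
  set g : ℝ³ → (Fin 3 → ℝ³) → ℝ³ := fun x a => deformInv a (f (deform a x)) - f x with hg
  -- pointwise Cauchy–Schwarz bound for `x ≠ 0`
  have hpt : ∀ x : ℝ³, x ≠ 0 →
      ‖average r f x - f x‖ₑ ^ 2 ≤ V⁻¹ * ∫⁻ a in Q, ‖g x a‖ₑ ^ 2 := by
    intro x hx
    have hint := integrableOn_conj_param hf hfi hr0 hr hx
    have hgm : AEStronglyMeasurable (g x) (volume.restrict Q) :=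
      hint.1.sub aestronglyMeasurable_const
    have h1 : average r f x - f x = (V⁻¹).toReal • ∫ a in Q, g x a := by
      rw [hg]
      show _ = _ • ∫ a in Q, (deformInv a (f (deform a x)) - f x)
      rw [integral_sub hint (integrableOn_const (measure_ball_lt_top.ne)), setIntegral_const,
        smul_sub, average, measureReal_def, smul_smul, ← ENNReal.toReal_mul,
        ENNReal.inv_mul_cancel hV0 hVtop, ENNReal.toReal_one, one_smul]
    have hCS : (∫⁻ a in Q, ‖g x a‖ₑ) ^ 2 ≤ V * ∫⁻ a in Q, ‖g x a‖ₑ ^ 2 := by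
      have h3 := ENNReal.lintegral_mul_le_Lp_mul_Lq (volume.restrict Q)
        Real.HolderConjugate.two_two (f := fun a => ‖g x a‖ₑ) (g := fun _ => 1)
        hgm.enorm aemeasurable_const
      simp only [Pi.mul_apply, mul_one, ENNReal.one_rpow, lintegral_const,
        Measure.restrict_apply_univ, one_div, one_mul] at h3
      calc (∫⁻ a in Q, ‖g x a‖ₑ) ^ 2
          ≤ ((∫⁻ a in Q, ‖g x a‖ₑ ^ (2 : ℝ)) ^ (2⁻¹ : ℝ) * V ^ (2⁻¹ : ℝ)) ^ 2 := by gcongr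
        _ = (∫⁻ a in Q, ‖g x a‖ₑ ^ (2 : ℝ)) * V := by
            rw [mul_pow, rpow_inv_two_sq, rpow_inv_two_sq]
        _ = V * ∫⁻ a in Q, ‖g x a‖ₑ ^ 2 := by
            rw [mul_comm]
            simp_rw [ENNReal.rpow_two]
    rw [h1, enorm_smul, Real.enorm_eq_ofReal ENNReal.toReal_nonneg,
      ENNReal.ofReal_toReal (ENNReal.inv_ne_top.2 hV0), mul_pow]
    calc V⁻¹ ^ 2 * ‖∫ a in Q, g x a‖ₑ ^ 2 ≤ V⁻¹ ^ 2 * (∫⁻ a in Q, ‖g x a‖ₑ) ^ 2 := by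
          gcongr
          exact enorm_integral_le_lintegral_enorm _
      _ ≤ V⁻¹ ^ 2 * (V * ∫⁻ a in Q, ‖g x a‖ₑ ^ 2) := by gcongr
      _ = V⁻¹ * ∫⁻ a in Q, ‖g x a‖ₑ ^ 2 := by
          rw [sq, mul_assoc, ← mul_assoc V⁻¹ V, ENNReal.inv_mul_cancel hV0 hVtop, one_mul]
  -- joint measurability on `B₁ × Q_r`
  have hgm2 : AEMeasurable (uncurry fun x a => ‖g x a‖ₑ ^ 2)
      ((volume.restrict (ball (0 : ℝ³) 1)).prod (volume.restrict Q)) := by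
    have h1 : AEStronglyMeasurable (fun p : ℝ³ × (Fin 3 → ℝ³) => deformInv p.2 (f (deform p.2 p.1)) - f p.1)
        ((volume.restrict (ball (0 : ℝ³) 1)).prod (volume.restrict Q)) :=
      ((aestronglyMeasurable_conj hf hr).mono_measure
        (Measure.prod_mono Measure.restrict_le_self le_rfl)).sub
        (hf.comp measurable_fst).aestronglyMeasurable
    exact (h1.enorm.pow_const 2)
  have hae : ∀ᵐ x ∂(volume.restrict (ball (0 : ℝ³) 1)),
      ‖average r f x - f x‖ₑ ^ 2 ≤ V⁻¹ * ∫⁻ a in Q, ‖g x a‖ₑ ^ 2 := by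
    have h0 : ∀ᵐ x ∂(volume.restrict (ball (0 : ℝ³) 1)), x ≠ (0 : ℝ³) :=
      ae_mono Measure.restrict_le_self (compl_mem_ae_iff.2 (measure_singleton (0 : ℝ³)))
    filter_upwards [h0] with x hx using hpt x hx
  calc ∫⁻ x in ball (0 : ℝ³) 1, ‖average r f x - f x‖ₑ ^ 2
      ≤ ∫⁻ x in ball (0 : ℝ³) 1, V⁻¹ * ∫⁻ a in Q, ‖g x a‖ₑ ^ 2 := lintegral_mono_ae hae
    _ = V⁻¹ * ∫⁻ x in ball (0 : ℝ³) 1, ∫⁻ a in Q, ‖g x a‖ₑ ^ 2 :=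
        lintegral_const_mul' _ _ (ENNReal.inv_ne_top.2 hV0)
    _ = V⁻¹ * ∫⁻ a in Q, ∫⁻ x in ball (0 : ℝ³) 1, ‖g x a‖ₑ ^ 2 := by
        rw [lintegral_lintegral_swap hgm2]
    _ ≤ V⁻¹ * ∫⁻ _ in Q, ε :=
        mul_le_mul_right (setLIntegral_mono' measurableSet_ball fun a ha =>
          hD a (mem_ball_zero_iff.1 ha)) _
    _ = ε := by
        rw [setLIntegral_const, mul_comm ε, ← mul_assoc, ENNReal.inv_mul_cancel hV0 hVtop, one_mul]


end LinearDeformation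

/-! ### DSS fields: iteration of the scaling identity, weak `L³` and Borel representatives -/

namespace BradshawTsai2019

/-- Iterating `c f(c x) = f(x)`: `cⁿ f(cⁿ x) = f(x)` for all `n : ℕ`. [folklore] -/
theorem pow_smul_apply_pow_smul {f : ℝ³ → ℝ³} {c : ℝ} (hf : nsRescaleData c f = f) (n : ℕ) (x : ℝ³) :
    c ^ n • f (c ^ n • x) = f x := by
  induction n generalizing x with
  | zero => simp
  | succ n ih =>
    have h := congrFun hf x
    rw [nsRescaleData_apply] at h
    rw [pow_succ, mul_smul, mul_smul, smul_comm (c ^ n) c, ih (c • x), h]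

/-- The inverse scaling: `c⁻¹ f(c⁻¹ x) = f(x)` if `c f(c x) = f(x)` for all `x`, `c ≠ 0`. [folklore] -/
theorem nsRescaleData_inv {f : ℝ³ → ℝ³} {c : ℝ} (hc : c ≠ 0) (hf : nsRescaleData c f = f) :
    nsRescaleData c⁻¹ f = f := by
  funext x
  have h := congrFun hf (c⁻¹ • x)
  rw [nsRescaleData_apply, smul_inv_smul₀ hc] at h
  rw [nsRescaleData_apply, ← h, inv_smul_smul₀ hc]

/-- Iterating `c f(c x) = f(x)` along `ℤ`: `cᵐ f(cᵐ x) = f(x)` for all `m : ℤ`, `c ≠ 0`. [folklore] -/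
theorem zpow_smul_apply_zpow_smul {f : ℝ³ → ℝ³} {c : ℝ} (hc : c ≠ 0) (hf : nsRescaleData c f = f)
    (m : ℤ) (x : ℝ³) : c ^ m • f (c ^ m • x) = f x := by
  cases m with
  | ofNat n => simpa using pow_smul_apply_pow_smul hf n x
  | negSucc n =>
    have h := pow_smul_apply_pow_smul (nsRescaleData_inv hc hf) (n + 1) x
    rwa [inv_pow, ← zpow_natCast, ← zpow_neg] at h

/-- **A DSS field bounded on the fundamental annulus decays like `|x|⁻¹`**: if `c f(c x) = f(x)`
for all `x` (`c > 1`) and `‖f‖ ≤ C` on `{1 ≤ ‖x‖ < c}`, then `‖f(x)‖ ≤ C c / ‖x‖` for all `x ≠ 0`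
(rescale `x` into the annulus by a power of `c`). [folklore] -/
theorem norm_le_div_norm_of_nsRescaleData {f : ℝ³ → ℝ³} {c : ℝ} (hc : 1 < c)
    (hf : nsRescaleData c f = f) {C : ℝ} (hC : ∀ x : ℝ³, 1 ≤ ‖x‖ → ‖x‖ < c → ‖f x‖ ≤ C)
    {x : ℝ³} (hx : x ≠ 0) : ‖f x‖ ≤ C * c / ‖x‖ := by
  have hc0 : 0 < c := zero_lt_one.trans hc
  have hxn : 0 < ‖x‖ := norm_pos_iff.2 hx
  obtain ⟨m, hm1, hm2⟩ := exists_mem_Ico_zpow hxn hc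
  have key := zpow_smul_apply_zpow_smul hc0.ne' hf (-m) x
  have hpos : 0 < c ^ (-m) := zpow_pos hc0 _
  have hnorm : ‖c ^ (-m) • x‖ = c ^ (-m) * ‖x‖ := by
    rw [norm_smul, Real.norm_of_nonneg hpos.le]
  have hy1 : 1 ≤ ‖c ^ (-m) • x‖ := by
    rw [hnorm, zpow_neg, ← div_eq_inv_mul, le_div_iff₀ (zpow_pos hc0 _), one_mul]
    exact hm1
  have hy2 : ‖c ^ (-m) • x‖ < c := by
    rw [hnorm, zpow_neg, ← div_eq_inv_mul, div_lt_iff₀ (zpow_pos hc0 _), mul_comm,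
      ← zpow_add_one₀ hc0.ne']
    exact hm2
  have hCy := hC _ hy1 hy2
  have hC0 : 0 ≤ C := (norm_nonneg _).trans hCy
  rw [← key, norm_smul, Real.norm_of_nonneg hpos.le]
  calc c ^ (-m) * ‖f (c ^ (-m) • x)‖ ≤ c ^ (-m) * C := by gcongr
    _ ≤ c / ‖x‖ * C := by
        refine mul_le_mul_of_nonneg_right ?_ hC0
        rw [le_div_iff₀ hxn, ← hnorm]
        exact hy2.le
    _ = C * c / ‖x‖ := by ring

/-- **`O(|x|⁻¹)` fields are weak-`L³`**: an a.e.-strongly measurable `g : ℝ³ → ℝ³` with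
`‖g(x)‖ ≤ C/‖x‖` for `x ≠ 0` lies in `L³_w(ℝ³)`: `t³ vol{‖g‖ > t} ≤ t³ vol(B(0, C/t)) = C³ vol(B₁)`
(Grafakos, Example 1.1.7). [folklore] -/
theorem memWeakLp_three_of_norm_le_div_norm {g : ℝ³ → ℝ³} (hgm : AEStronglyMeasurable g volume)
    {C : ℝ} (hC : 0 ≤ C) (hb : ∀ x : ℝ³, x ≠ 0 → ‖g x‖ ≤ C / ‖x‖) :
    FunctionSpaces.MemWeakLp g 3 volume := by
  refine ⟨hgm, lt_of_le_of_lt (FunctionSpaces.eWeakLpPow_le_iff.2 fun t => ?_)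
    (show ENNReal.ofReal (C ^ 3) * volume (ball (0 : ℝ³) 1) < ⊤ from
      ENNReal.mul_lt_top ENNReal.ofReal_lt_top measure_ball_lt_top)⟩
  rw [show (3 : ℝ≥0∞).toReal = ((3 : ℕ) : ℝ) by norm_num, ENNReal.rpow_natCast]
  rcases eq_or_ne t 0 with rfl | ht0
  · simp
  have ht : 0 < (t : ℝ) := NNReal.coe_pos.2 (pos_iff_ne_zero.2 ht0)
  have hsub : {x : ℝ³ | (t : ℝ≥0∞) < ‖g x‖ₑ} ⊆ insert 0 (ball (0 : ℝ³) (C / t)) := by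
    intro x hx
    rw [mem_setOf_eq] at hx
    by_cases hx0 : x = 0
    · exact Or.inl hx0
    · refine Or.inr (mem_ball_zero_iff.2 ?_)
      have h1 : (t : ℝ) < ‖g x‖ := by
        rw [← ofReal_norm, ← ENNReal.ofReal_coe_nnreal,
          ENNReal.ofReal_lt_ofReal_iff_of_nonneg (NNReal.coe_nonneg t)] at hx
        exact hx
      have h2 := h1.trans_le (hb x hx0)
      rw [lt_div_iff₀ (norm_pos_iff.2 hx0)] at h2
      rwa [lt_div_iff₀ ht, mul_comm]
  calc (t : ℝ≥0∞) ^ 3 * volume {x : ℝ³ | (t : ℝ≥0∞) < ‖g x‖ₑ}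
      ≤ (t : ℝ≥0∞) ^ 3 * volume (insert (0 : ℝ³) (ball (0 : ℝ³) (C / t))) := by
        gcongr
    _ ≤ (t : ℝ≥0∞) ^ 3 * volume (ball (0 : ℝ³) (C / t)) := by
        gcongr (t : ℝ≥0∞) ^ 3 * ?_
        calc volume (insert (0 : ℝ³) (ball (0 : ℝ³) (C / t)))
            ≤ volume ({(0 : ℝ³)} : Set ℝ³) + volume (ball (0 : ℝ³) (C / t)) := by
              rw [insert_eq]
              exact measure_union_le _ _
          _ = volume (ball (0 : ℝ³) (C / t)) := by rw [measure_singleton, zero_add]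
    _ = (t : ℝ≥0∞) ^ 3 * (ENNReal.ofReal ((C / t) ^ 3) * volume (ball (0 : ℝ³) 1)) := by
        rw [Measure.addHaar_ball _ _ (div_nonneg hC ht.le), finrank_euclideanSpace_fin]
    _ = ENNReal.ofReal (C ^ 3) * volume (ball (0 : ℝ³) 1) := by
        rw [← mul_assoc, ← ENNReal.ofReal_coe_nnreal, ← ENNReal.ofReal_pow (NNReal.coe_nonneg t),
          ← ENNReal.ofReal_mul (pow_nonneg (NNReal.coe_nonneg t) _), ← mul_pow,
          mul_div_cancel₀ _ ht.ne']

/-- **A Borel, pointwise-DSS representative.** An a.e.-strongly measurable field `f` with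
`c f(c x) = f(x)` for all `x` (`c ≠ 0`) agrees a.e. with a Borel measurable `g` which again
satisfies `c g(c x) = g(x)` for *all* `x`: take a measurable null set `Z` off which `f` equals its
measurable modification `f̃`, the `c^ℤ`-invariant conull measurable set
`E = {x : cⁿ x ∉ Z for all n ∈ ℤ}`, and `g = 1_E f̃`. [folklore] -/
theorem exists_measurable_dss_representative {f : ℝ³ → ℝ³} {c : ℝ} (hc : c ≠ 0)
    (hf : AEStronglyMeasurable f volume) (hdss : nsRescaleData c f = f) :
    ∃ g : ℝ³ → ℝ³, Measurable g ∧ g =ᵐ[volume] f ∧ nsRescaleData c g = g := by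
  obtain ⟨Z, hZm, hZ0, hZf⟩ : ∃ Z : Set ℝ³, MeasurableSet Z ∧ volume Z = 0 ∧
      ∀ x, x ∉ Z → f x = hf.mk f x := by
    have h := hf.ae_eq_mk
    rw [Filter.EventuallyEq, ae_iff] at h
    obtain ⟨Z, hsub, hZm, hZ0⟩ := exists_measurable_superset_of_null h
    exact ⟨Z, hZm, hZ0, fun x hx => by_contra fun hne => hx (hsub hne)⟩
  set E : Set ℝ³ := {x | ∀ n : ℤ, c ^ n • x ∉ Z} with hE
  have hEeq : E = ⋂ n : ℤ, (fun x : ℝ³ => c ^ n • x) ⁻¹' Zᶜ := by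
    ext x
    simp [hE]
  have hEm : MeasurableSet E := by
    rw [hEeq]
    exact MeasurableSet.iInter fun n => (measurable_const_smul (c ^ n)) hZm.compl
  have hEae : ∀ᵐ x ∂(volume : Measure ℝ³), x ∈ E := by
    have hc' : Eᶜ = ⋃ n : ℤ, (fun x : ℝ³ => c ^ n • x) ⁻¹' Z := by
      rw [hEeq, compl_iInter]
      simp
    show E ∈ ae volume
    rw [mem_ae_iff, hc', measure_iUnion_null_iff]
    intro n
    rw [Measure.addHaar_preimage_smul volume (zpow_ne_zero n hc), hZ0, mul_zero]
  have hmemE : ∀ x, x ∈ E ↔ c • x ∈ E := by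
    intro x
    constructor
    · intro hx n
      have h1 := hx (n + 1)
      rwa [zpow_add_one₀ hc, mul_smul] at h1
    · intro hx n
      have h1 := hx (n - 1)
      rwa [smul_smul, ← zpow_add_one₀ hc, sub_add_cancel] at h1
  refine ⟨E.indicator (hf.mk f), hf.stronglyMeasurable_mk.measurable.indicator hEm, ?_, ?_⟩
  · filter_upwards [hEae] with x hx
    rw [indicator_of_mem hx]
    have h0 : x ∉ Z := by simpa using hx 0
    exact (hZf x h0).symm
  · funext x
    rw [nsRescaleData_apply]
    by_cases hx : x ∈ E
    · have hcx : c • x ∈ E := (hmemE x).1 hx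
      rw [indicator_of_mem hx, indicator_of_mem hcx]
      have h1 : c • x ∉ Z := by simpa using hcx 0
      have h2 : x ∉ Z := by simpa using hx 0
      rw [← hZf _ h1, ← hZf _ h2]
      exact congrFun hdss x
    · have hcx : c • x ∉ E := fun h => hx ((hmemE x).2 h)
      rw [indicator_of_notMem hx, indicator_of_notMem hcx, smul_zero]

end BradshawTsai2019

/-! ### Lemma 4.1 -/

/-- **Discharge of Bradshaw–Tsai 2019, Lemma 4.1** (`bradshawTsai2019_lemma_4_1`): every
divergence free `λ`-DSS field `f ∈ L²_loc(ℝ³; ℝ³)`, `λ > 1`, is the `L²(B₁)`-limit of divergence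
free `λ`-DSS fields in `L³_w(ℝ³)`.

The proof given here is **not** the printed one (Bogovskiĭ's operator on annuli, loc. cit. §4.1);
it averages over linear changes of variables instead. Replace `f` by a Borel representative which
is still `λ`-DSS pointwise (`BradshawTsai2019.exists_measurable_dss_representative`), and put
`φ⁽ᵏ⁾ = A_{r_k} f = vol(Q_{r_k})⁻¹ ∫_{Q_{r_k}} T_a⁻¹ f(T_a ·) da` with `T_a x = x + ∑ⱼ xⱼ aⱼ` and
`r_k ↓ 0` (`LinearDeformation.average`). Linear conjugation commutes with the scaling
`x ↦ λ x` and preserves weak divergence-freeness, so each `φ⁽ᵏ⁾` is `λ`-DSS and divergence free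
(`LinearDeformation.nsRescaleData_average`, `LinearDeformation.isWeaklyDivFree_average`, Fubini);
averaging over one column of `a` is a genuine three-dimensional average of `f`, whence `φ⁽ᵏ⁾` is
bounded on the annulus `1 ≤ |x| ≤ λ` by a local `L¹` norm of `f` (`LinearDeformation.enorm_average_le`)
and therefore `|φ⁽ᵏ⁾(x)| ≤ c_k |x|⁻¹`, i.e. `φ⁽ᵏ⁾ ∈ L³_w` exactly as in print; finally
`‖φ⁽ᵏ⁾ − f‖_{L²(B₁)} → 0` by the continuity of linear deformations on `L²_loc`
(`LinearDeformation.exists_forall_setLIntegral_conj_sub_sq_le`, Cauchy–Schwarz and Tonelli).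
[cite: BradshawTsai2019, Lemma 4.1] -/
theorem bradshawTsai2019_lemma_4_1_holds : bradshawTsai2019_lemma_4_1 := by
  intro c hc f hfm hL2 hdiv hdss
  have hc0 : 0 < c := zero_lt_one.trans hc
  obtain ⟨g, hgm, hgf, hgdss⟩ :=
    BradshawTsai2019.exists_measurable_dss_representative hc0.ne' hfm hdss
  -- transfer the hypotheses to the representative `g`
  have hgL2 : LocallyIntegrable (fun x => ‖g x‖ ^ 2) volume :=
    hL2.congr (by filter_upwards [hgf] with x hx; rw [hx])
  have hgi : LocallyIntegrable g volume :=
    (hgL2.add (locallyIntegrable_const 1)).mono hgm.aestronglyMeasurable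
      (Eventually.of_forall fun x => by
        rw [Pi.add_apply, Real.norm_of_nonneg (by positivity)]
        nlinarith [norm_nonneg (g x)])
  have hgdiv : IsWeaklyDivFree g := fun θ hθ => by
    rw [← hdiv θ hθ]
    refine integral_congr_ae ?_
    filter_upwards [hgf] with x hx
    rw [hx]
  have hg3 : ∫⁻ x in ball (0 : ℝ³) 3, ‖g x‖ₑ ^ 2 < ⊤ :=
    BradshawTsai2019.setLIntegral_ball_enorm_sq_lt_top hgL2 3
  -- the radii `r_k`
  have hchoice : ∀ k : ℕ, ∃ r : ℝ, 0 < r ∧ r ≤ LinearDeformation.radius ∧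
      ∫⁻ x in ball (0 : ℝ³) 1, ‖LinearDeformation.average r g x - g x‖ₑ ^ 2 ≤
        ((k + 1 : ℕ) : ℝ≥0∞)⁻¹ := by
    intro k
    obtain ⟨δ, hδ, hδr, hD⟩ := LinearDeformation.exists_forall_setLIntegral_conj_sub_sq_le hgm hg3
      (ε := ((k + 1 : ℕ) : ℝ≥0∞)⁻¹) (ENNReal.inv_pos.2 (ENNReal.natCast_ne_top _))
    exact ⟨δ, hδ, hδr, LinearDeformation.setLIntegral_average_sub_sq_le hgm hgi hδ hδr hD⟩
  choose r hr0 hrρ hrD using hchoice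
  refine ⟨fun k => LinearDeformation.average (r k) g, fun k => ?_,
    fun k => LinearDeformation.isWeaklyDivFree_average hgm hgi hgdiv (hr0 k) (hrρ k),
    fun k => LinearDeformation.nsRescaleData_average hgdss (r k), ?_⟩
  · -- weak `L³`: bounded on the fundamental annulus, then `O(|x|⁻¹)` by self-similarity
    set ψ := LinearDeformation.average (r k) g with hψ
    set M : ℝ≥0∞ := 2 * (volume (ball (0 : ℝ³) (r k)))⁻¹ *
      (8 * ∫⁻ y in ball (0 : ℝ³) (2 * c), ‖g y‖ₑ) with hM
    have hMtop : M ≠ ⊤ := ENNReal.mul_ne_top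
      (ENNReal.mul_ne_top ENNReal.ofNat_ne_top (ENNReal.inv_ne_top.2 (measure_ball_pos _ _ (hr0 k)).ne'))
      (ENNReal.mul_ne_top ENNReal.ofNat_ne_top (LinearDeformation.setLIntegral_ball_enorm_lt_top hgi _).ne)
    have hann : ∀ x : ℝ³, 1 ≤ ‖x‖ → ‖x‖ < c → ‖ψ x‖ ≤ M.toReal := by
      intro x hx1 hxc
      have hx : x ≠ 0 := norm_pos_iff.1 (zero_lt_one.trans_le hx1)
      obtain ⟨j₀, hj, hj'⟩ := LinearDeformation.exists_coord_ne_zero hx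
      have hcoord : |(x j₀ ^ 3)⁻¹| ≤ 8 := by
        have h1 : (1 : ℝ) / 4 < x j₀ ^ 2 := by nlinarith
        have h2 : (1 : ℝ) / 2 < |x j₀| := by
          rw [← sq_abs] at h1
          nlinarith [abs_nonneg (x j₀)]
        have h3 : ((1 : ℝ) / 2) ^ 3 < |x j₀| ^ 3 := pow_lt_pow_left₀ h2 (by norm_num) three_ne_zero
        rw [abs_inv, abs_pow, inv_le_comm₀ (pow_pos (abs_pos.2 hj) 3) (by norm_num)]
        norm_num at h3 ⊢
        exact h3.le
      have hle : ‖ψ x‖ₑ ≤ M := by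
        refine (LinearDeformation.enorm_average_le hgm (hr0 k) (hrρ k) hx hj).trans ?_
        rw [hM]
        refine mul_le_mul_right (mul_le_mul' ?_ (lintegral_mono_set (ball_subset_ball (by linarith)))) _
        calc ENNReal.ofReal |(x j₀ ^ 3)⁻¹| ≤ ENNReal.ofReal 8 := ENNReal.ofReal_le_ofReal hcoord
          _ = 8 := ENNReal.ofReal_ofNat 8
      rw [← ofReal_norm] at hle
      exact (ENNReal.ofReal_le_iff_le_toReal hMtop).1 hle
    have hbound : ∀ x : ℝ³, x ≠ 0 → ‖ψ x‖ ≤ M.toReal * c / ‖x‖ := fun x hx =>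
      BradshawTsai2019.norm_le_div_norm_of_nsRescaleData hc
        (LinearDeformation.nsRescaleData_average hgdss (r k)) hann hx
    exact BradshawTsai2019.memWeakLp_three_of_norm_le_div_norm
      (LinearDeformation.aestronglyMeasurable_average hgm (hrρ k)) (by positivity) hbound
  · -- convergence in `L²(B₁)`
    have heq : ∀ k, ∫⁻ x in ball (0 : ℝ³) 1, ‖LinearDeformation.average (r k) g x - f x‖ₑ ^ 2 =
        ∫⁻ x in ball (0 : ℝ³) 1, ‖LinearDeformation.average (r k) g x - g x‖ₑ ^ 2 := by
      intro k
      refine lintegral_congr_ae ?_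
      filter_upwards [ae_restrict_of_ae hgf] with x hx
      rw [hx]
    refine tendsto_of_tendsto_of_tendsto_of_le_of_le tendsto_const_nhds
      (ENNReal.tendsto_inv_nat_nhds_zero.comp (tendsto_add_atTop_nat 1)) (fun k => zero_le)
      fun k => ?_
    rw [heq]
    exact hrD k

end Literature.Analysis.FluidPDE

end
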